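import Literature.Analysis.Complex.LoewnerFastTrackBendatSherman
import HarnessLib

/-!
# Loewner's theorem, Part I — step 6: the fast track (Hansen 2013, §§4–5) and the discharge of
# `Literature.Analysis.Complex.loewner_theorem`

Sixth and last brick of the hard direction (`→`) of the named fact
`Literature.Analysis.Complex.loewner_theorem` along F. Hansen's "fast track"
(*The fast track to Löwner's theorem*, Linear Algebra Appl. 438 (2013) 4557–4571, [Hansen2013]),
ending with the discharge `loewner_theorem_holds`. Contents, following the paper:

* §4 preliminaries: `t ↦ -1/t` is operator monotone and composition with `1/t` exchanges operator
  monotone and operator decreasing functions (`isMatrixMonotoneOn_neg_inv`,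
  `isMatrixMonotoneOn_comp_inv_of_neg`); Hansen's Lemma 4.1 (`isMatrixMonotoneOn_neg_div`:
  `t ↦ f(t)/t` is operator decreasing for nonnegative operator monotone `f`, here obtained from the
  Bendat–Sherman theorem of brick 5 by letting the base point tend to `0⁺`), Corollary 4.2 (the
  involutions `f♯ = t/f(t)` and `f* = t f(1/t)`, `isMatrixMonotoneOn_sharp`, `isMatrixMonotoneOn_star`),
  Lemma 4.3 (`le_add_one_of_isMatrixMonotoneOn`), Corollary 3.10 in the forms needed
  (`deriv_pos_of_isMatrixMonotoneOn`, `strictMonoOn_of_isMatrixMonotoneOn`), Theorem 4.4 (the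
  transform `T`, `isMatrixMonotoneOn_hansenT`, `hansenT_identity`, `hansenT_pos`), Lemma 4.6
  (`hasDerivAt_star_one`).
* The class `𝒫₀` of nonnegative operator monotone `g` on `(0, ∞)` with `g(1) = 1`, realised in
  `ℝ → ℝ` (extended by `0` on `(-∞, 0]`, written out as a set at each use since this file
  introduces no definitions or notation): stability under `*` and `T`, `g'(1) ∈ [0, 1]`, Hansen's Lemma 4.8
  (`extremePoints_normalised_subset`: extreme points are among `t/(λ + (1 - λ)t)`), convexity,
  closedness and compactness in the topology of pointwise convergence (Lemma 4.3 and Tychonoff).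
* Theorem 4.9 (`exists_measure_repr_of_normalised`): Krein–Milman (Mathlib's
  `closure_convexHull_extremePoints`) represents `g ∈ 𝒫₀` as `∫₀¹ t/(λ + (1 - λ)t) dμ(λ)`; the
  limit of the discrete representing measures is organised through the weak-* compact set of
  positive normalised functionals on `C([0, 1])` (Banach–Alaoglu) and the Riesz–Markov–Kakutani
  theorem. Combined with Theorem 4.4: `f(t) = f(1) + f'(1) ∫₀¹ (t - 1)/(λ + (1 - λ)t) dμ(λ)` for every
  non-constant operator monotone `f` on `(0, ∞)` (`exists_measure_repr_of_isMatrixMonotoneOn`).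
* §5.1 (`exists_pick_extension_Ioi`): the same formula with complex `z` is holomorphic on the slit
  plane `ℂ \ (-∞, 0]` (dominated holomorphic parameter integral), real-symmetric, and has
  `Im = f'(1) Im z ∫ |λ + (1 - λ)z|⁻² dμ ≥ 0` on the upper half-plane (this replaces the detour through
  Theorem 5.2).
* Theorem 5.4 (reductions): `(a, ∞)` by translation, `(-∞, b)` by the reflection `-f(-t)`,
  `(a, b)` by an affine map and Hansen's operator monotone bijection `u ↦ u/(1 + u)` of `(0, ∞)` onto
  `(0, 1)` (whose inverse `w ↦ w/(1 - w)` preserves the half-planes), and `ℝ` by gluing the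
  half-line extensions with the identity theorem; an open order-connected `Δ` is one of these by
  `IsPreconnected.mem_intervals`.
* `loewner_theorem_holds`: (→) as above, (←) is `loewner_theorem_mpr`
  (file `PickFunctionsProofs`).
-/

noncomputable section

open scoped ComplexOrder ComplexConjugate MatrixOrder Matrix.Norms.L2Operator
open Complex Set Filter Topology Metric Real Matrix Polynomial

namespace Literature.Analysis.Complex

section MonotoneAlgebra

variable {n : ℕ}

/-- Matrix monotonicity only depends on the values on `Δ`. [folklore] -/
theorem isMatrixMonotoneOn_congr {f g : ℝ → ℝ} {Δ : Set ℝ} (h : EqOn f g Δ)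
    (hf : IsMatrixMonotoneOn f Δ) : IsMatrixMonotoneOn g Δ := by
  intro n A B hA hB hAs hBs hAB
  rw [← cfc_congr fun x hx => h (hAs hx), ← cfc_congr fun x hx => h (hBs hx)]
  exact hf n A B hA hB hAs hBs hAB

/-- Sums of matrix monotone functions are matrix monotone. [folklore] -/
theorem isMatrixMonotoneOn_add {f g : ℝ → ℝ} {Δ : Set ℝ} (hf : IsMatrixMonotoneOn f Δ)
    (hg : IsMatrixMonotoneOn g Δ) : IsMatrixMonotoneOn (fun t => f t + g t) Δ := by
  intro n A B hA hB hAs hBs hAB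
  have hfinA := Matrix.finite_real_spectrum (A := A)
  have hfinB := Matrix.finite_real_spectrum (A := B)
  rw [cfc_add (a := B) f g (hf := hfinB.continuousOn _) (hg := hfinB.continuousOn _),
    cfc_add (a := A) f g (hf := hfinA.continuousOn _) (hg := hfinA.continuousOn _)]
  have e : cfc f B + cfc g B - (cfc f A + cfc g A) = (cfc f B - cfc f A) + (cfc g B - cfc g A) := by
    abel
  rw [e]
  exact (hf n A B hA hB hAs hBs hAB).add (hg n A B hA hB hAs hBs hAB)

/-- Nonnegative multiples of matrix monotone functions are matrix monotone. [folklore] -/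
theorem isMatrixMonotoneOn_const_mul {f : ℝ → ℝ} {Δ : Set ℝ} {c : ℝ} (hc : 0 ≤ c)
    (hf : IsMatrixMonotoneOn f Δ) : IsMatrixMonotoneOn (fun t => c * f t) Δ := by
  intro n A B hA hB hAs hBs hAB
  rw [cfc_const_mul (a := B) c f (hf := (Matrix.finite_real_spectrum (A := B)).continuousOn _),
    cfc_const_mul (a := A) c f (hf := (Matrix.finite_real_spectrum (A := A)).continuousOn _),
    ← smul_sub]
  exact (hf n A B hA hB hAs hBs hAB).smul hc

/-- Constants are matrix monotone. [folklore] -/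
theorem isMatrixMonotoneOn_constFun (c : ℝ) (Δ : Set ℝ) : IsMatrixMonotoneOn (fun _ => c) Δ := by
  intro n A B hA hB hAs hBs hAB
  rw [cfc_const c B, cfc_const c A, sub_self]
  exact PosSemidef.zero

/-- The identity is matrix monotone. [folklore] -/
theorem isMatrixMonotoneOn_idFun (Δ : Set ℝ) : IsMatrixMonotoneOn (fun t => t) Δ := by
  intro n A B hA hB hAs hBs hAB
  rw [cfc_id' ℝ B, cfc_id' ℝ A]
  exact hAB

/-- The functional calculus of `t ↦ t⁻¹` on a positive definite matrix is the matrix inverse.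
[folklore] -/
theorem cfc_inv_self {A : Matrix (Fin n) (Fin n) ℂ} (hA : A.IsHermitian)
    (hAs : spectrum ℝ A ⊆ Ioi 0) : cfc (fun t : ℝ => t⁻¹) A = A⁻¹ := by
  have hA' : IsSelfAdjoint A := hA
  have h := cfc_inv (fun t : ℝ => t) A (fun x hx => (ne_of_gt (hAs hx) : x ≠ 0))
  rw [h, cfc_id' ℝ A, Matrix.nonsing_inv_eq_ringInverse]

/-- Composition with the inverse: `cfc (g ∘ ⁻¹) A = cfc g A⁻¹`. [folklore] -/
theorem cfc_comp_inv {A : Matrix (Fin n) (Fin n) ℂ} (hA : A.IsHermitian)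
    (hAs : spectrum ℝ A ⊆ Ioi 0) (g : ℝ → ℝ) : cfc (fun t : ℝ => g t⁻¹) A = cfc g A⁻¹ := by
  have hA' : IsSelfAdjoint A := hA
  have hfin := Matrix.finite_real_spectrum (A := A)
  rw [← cfc_inv_self hA hAs]
  exact cfc_comp' g (fun t : ℝ => t⁻¹) A ((hfin.image _).continuousOn _) (hfin.continuousOn _)

/-- Spectral data of the inverse of a positive definite matrix. [folklore] -/
theorem inv_isHermitian_spectrum {A : Matrix (Fin n) (Fin n) ℂ} (hA : A.IsHermitian)
    (hAs : spectrum ℝ A ⊆ Ioi 0) : A⁻¹.IsHermitian ∧ spectrum ℝ A⁻¹ ⊆ Ioi 0 := by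
  have hpd : A⁻¹.PosDef := (posDef_of_spectrum_subset_Ioi hA hAs).inv
  exact ⟨hpd.1, fun x hx => spectrum_subset_Ioi_of_posDef hpd hx⟩

/-- `t ↦ -t⁻¹` is operator monotone on `(0, ∞)` (the inverse is operator decreasing).
[cite: Hansen2013, §4] -/
theorem isMatrixMonotoneOn_neg_inv : IsMatrixMonotoneOn (fun t : ℝ => -t⁻¹) (Ioi 0) := by
  intro n A B hA hB hAs hBs hAB
  rw [cfc_neg (fun t : ℝ => t⁻¹) B, cfc_neg (fun t : ℝ => t⁻¹) A, cfc_inv_self hA hAs,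
    cfc_inv_self hB hBs]
  have h := inv_le_inv_of_posDef (posDef_of_spectrum_subset_Ioi hA hAs)
    (by rw [Matrix.le_iff]; exact hAB)
  rw [Matrix.le_iff] at h
  have e : -B⁻¹ - -A⁻¹ = A⁻¹ - B⁻¹ := by abel
  rw [e]; exact h

/-- Composition with the operator decreasing map `t ↦ t⁻¹` turns operator decreasing functions on
`(0, ∞)` into operator monotone ones. [cite: Hansen2013, §4] -/
theorem isMatrixMonotoneOn_comp_inv_of_neg {g : ℝ → ℝ}
    (hg : IsMatrixMonotoneOn (fun t => -g t) (Ioi 0)) :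
    IsMatrixMonotoneOn (fun t => g t⁻¹) (Ioi 0) := by
  intro n A B hA hB hAs hBs hAB
  obtain ⟨hAi, hAis⟩ := inv_isHermitian_spectrum hA hAs
  obtain ⟨hBi, hBis⟩ := inv_isHermitian_spectrum hB hBs
  have hinv : (A⁻¹ - B⁻¹).PosSemidef := by
    have h := inv_le_inv_of_posDef (posDef_of_spectrum_subset_Ioi hA hAs)
      (by rw [Matrix.le_iff]; exact hAB)
    rw [Matrix.le_iff] at h; exact h
  have h := hg n B⁻¹ A⁻¹ hBi hAi hBis hAis hinv
  rw [cfc_neg, cfc_neg] at h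
  rw [cfc_comp_inv hA hAs, cfc_comp_inv hB hBs]
  have e : cfc g B⁻¹ - cfc g A⁻¹ = -cfc g A⁻¹ - -cfc g B⁻¹ := by abel
  rw [e]; exact h

/-- Composition with `t ↦ t⁻¹` turns operator monotone functions on `(0, ∞)` into operator
decreasing ones. [cite: Hansen2013, §4] -/
theorem isMatrixMonotoneOn_neg_comp_inv {g : ℝ → ℝ} (hg : IsMatrixMonotoneOn g (Ioi 0)) :
    IsMatrixMonotoneOn (fun t => -g t⁻¹) (Ioi 0) := by
  have h := isMatrixMonotoneOn_comp_inv_of_neg (g := fun t => -g t) (by simpa using hg)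
  exact h

/-- The spectrum of `cfc h A` lies in `(0, ∞)` when `h > 0` on the spectrum. [folklore] -/
theorem spectrum_cfc_subset_Ioi {A : Matrix (Fin n) (Fin n) ℂ} (hA : A.IsHermitian) {h : ℝ → ℝ}
    (hpos : ∀ x ∈ spectrum ℝ A, 0 < h x) : spectrum ℝ (cfc h A) ⊆ Ioi 0 := by
  have hA' : IsSelfAdjoint A := hA
  rw [cfc_map_spectrum h A (hf := (Matrix.finite_real_spectrum (A := A)).continuousOn _)]
  rintro _ ⟨x, hx, rfl⟩
  exact hpos x hx

end MonotoneAlgebra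

section FastTrackInvolutions

variable {n : ℕ}

/-- The inverse of a positive operator decreasing function on `(0, ∞)` is operator monotone.
[cite: Hansen2013, Corollary 4.2 (proof)] -/
theorem isMatrixMonotoneOn_inv_of_neg {h : ℝ → ℝ} (hh : IsMatrixMonotoneOn (fun t => -h t) (Ioi 0))
    (hpos : ∀ t, 0 < t → 0 < h t) : IsMatrixMonotoneOn (fun t => (h t)⁻¹) (Ioi 0) := by
  intro n A B hA hB hAs hBs hAB
  have hA' : IsSelfAdjoint A := hA
  have hB' : IsSelfAdjoint B := hB
  have hfinA := Matrix.finite_real_spectrum (A := A)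
  have hfinB := Matrix.finite_real_spectrum (A := B)
  -- `h(B) ≤ h(A)`, both positive definite
  have hle : cfc h B ≤ cfc h A := by
    have h1 := hh n A B hA hB hAs hBs hAB
    rw [cfc_neg, cfc_neg] at h1
    rw [Matrix.le_iff]
    have e : cfc h A - cfc h B = -cfc h B - -cfc h A := by abel
    rw [e]; exact h1
  have hBh : (cfc h B).IsHermitian := (cfc_predicate h B : IsSelfAdjoint _)
  have hBpd : (cfc h B).PosDef :=
    posDef_of_spectrum_subset_Ioi hBh (spectrum_cfc_subset_Ioi hB fun x hx => hpos x (hBs hx))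
  have hinv := inv_le_inv_of_posDef hBpd hle
  -- identify the inverses with the functional calculus of `h⁻¹`
  have eA : cfc (fun t => (h t)⁻¹) A = (cfc h A)⁻¹ := by
    rw [cfc_inv h A (fun x hx => (hpos x (hAs hx)).ne') (hf := hfinA.continuousOn _),
      Matrix.nonsing_inv_eq_ringInverse]
  have eB : cfc (fun t => (h t)⁻¹) B = (cfc h B)⁻¹ := by
    rw [cfc_inv h B (fun x hx => (hpos x (hBs hx)).ne') (hf := hfinB.continuousOn _),
      Matrix.nonsing_inv_eq_ringInverse]
  rw [eA, eB, ← Matrix.le_iff]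
  exact hinv

/-- **Hansen's Lemma 4.1**: for a nonnegative operator monotone function `f` on `(0, ∞)` the
function `t ↦ t⁻¹ f(t)` is operator monotone decreasing. Proof (variant of Hansen's): by the
Bendat–Sherman theorem `t ↦ [t₀, t]_f` is operator decreasing for every `t₀ > 0`; letting
`t₀ → 0⁺` gives that `(f(t) - f(0⁺))/t` is operator decreasing, and `f(0⁺) ≥ 0` while `1/t` is
operator decreasing. [cite: Hansen2013, Lemma 4.1] -/
theorem isMatrixMonotoneOn_neg_div {f : ℝ → ℝ} (hf : IsMatrixMonotoneOn f (Ioi 0))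
    (hpos : ∀ t, 0 < t → 0 ≤ f t) : IsMatrixMonotoneOn (fun t => -(f t / t)) (Ioi 0) := by
  have hmono := monotoneOn_of_isMatrixMonotoneOn hf
  -- the base points `s k = 1/(k+1) → 0⁺` and the limit `L = f(0⁺)`
  set s : ℕ → ℝ := fun k => 1 / ((k : ℝ) + 1) with hs
  have hspos : ∀ k, 0 < s k := fun k => by rw [hs]; positivity
  have hslim : Tendsto s atTop (𝓝 0) := tendsto_one_div_add_atTop_nhds_zero_nat
  set u : ℕ → ℝ := fun k => f (s k) with hu
  have huanti : Antitone u := by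
    intro k l hkl
    refine hmono (hspos l) (hspos k) ?_
    rw [hs]; dsimp only
    gcongr
  have hubdd : BddBelow (range u) := ⟨0, by rintro _ ⟨k, rfl⟩; exact hpos _ (hspos k)⟩
  set L : ℝ := ⨅ k, u k with hL
  have hulim : Tendsto u atTop (𝓝 L) := tendsto_atTop_ciInf huanti hubdd
  have hL0 : 0 ≤ L := le_ciInf fun k => hpos _ (hspos k)
  -- Bendat–Sherman at each base point
  choose c hc hcm using fun k => exists_hasDerivAt_dividedDiff_antitone hf (hspos k)
  -- the limit function `-(f t - L)/t` is operator monotone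
  have hlimfun : IsMatrixMonotoneOn (fun t => -((f t - L) / t)) (Ioi 0) := by
    intro n A B hA hB hAs hBs hAB
    have hpt : ∀ t, 0 < t → Tendsto (fun k => -(if t = s k then c k else slope f (s k) t)) atTop
        (𝓝 (-((f t - L) / t))) := by
      intro t ht
      have hev : ∀ᶠ k in atTop, s k < t := hslim (Iio_mem_nhds ht)
      have h1 : Tendsto (fun k => -((f t - u k) / (t - s k))) atTop (𝓝 (-((f t - L) / (t - 0)))) :=
        ((tendsto_const_nhds.sub hulim).div (tendsto_const_nhds.sub hslim) (by simp [ht.ne'])).neg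
      rw [sub_zero] at h1
      refine h1.congr' ?_
      filter_upwards [hev] with k hk
      rw [if_neg (ne_of_gt hk), slope_def_field]
    exact posSemidef_cfc_sub_cfc_of_tendsto hA hB (fun x hx => hpt x (hAs hx))
      (fun x hx => hpt x (hBs hx)) fun k => hcm k n A B hA hB hAs hBs hAB
  -- add the operator monotone function `L · (-1/t)`
  have hsum := isMatrixMonotoneOn_add hlimfun
    (isMatrixMonotoneOn_const_mul hL0 isMatrixMonotoneOn_neg_inv)
  refine isMatrixMonotoneOn_congr (fun t ht => ?_) hsum
  have ht' : t ≠ 0 := ne_of_gt ht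
  field_simp
  ring

/-- **Hansen's Corollary 4.2, first involution**: for a positive operator monotone function `f`
on `(0, ∞)`, `f♯(t) = t / f(t)` is operator monotone. [cite: Hansen2013, Corollary 4.2] -/
theorem isMatrixMonotoneOn_sharp {f : ℝ → ℝ} (hf : IsMatrixMonotoneOn f (Ioi 0))
    (hpos : ∀ t, 0 < t → 0 < f t) : IsMatrixMonotoneOn (fun t => t / f t) (Ioi 0) := by
  have h := isMatrixMonotoneOn_inv_of_neg (isMatrixMonotoneOn_neg_div hf fun t ht => (hpos t ht).le)
    fun t ht => div_pos (hpos t ht) ht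
  refine isMatrixMonotoneOn_congr (fun t _ => ?_) h
  simp only [inv_div]

/-- **Hansen's Corollary 4.2, second involution**: for a positive operator monotone function `f`
on `(0, ∞)`, `f*(t) = t f(1/t)` is operator monotone. [cite: Hansen2013, Corollary 4.2] -/
theorem isMatrixMonotoneOn_star {f : ℝ → ℝ} (hf : IsMatrixMonotoneOn f (Ioi 0))
    (hpos : ∀ t, 0 < t → 0 < f t) : IsMatrixMonotoneOn (fun t => t * f t⁻¹) (Ioi 0) := by
  -- `k(t) = 1 / f(1/t)` is positive and operator monotone
  have hk : IsMatrixMonotoneOn (fun t => (f t⁻¹)⁻¹) (Ioi 0) :=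
    isMatrixMonotoneOn_inv_of_neg (h := fun t => f t⁻¹) (isMatrixMonotoneOn_neg_comp_inv hf)
      fun t ht => hpos _ (inv_pos.mpr ht)
  have h := isMatrixMonotoneOn_sharp hk fun t ht => inv_pos.mpr (hpos _ (inv_pos.mpr ht))
  refine isMatrixMonotoneOn_congr (fun t _ => ?_) h
  simp only [div_inv_eq_mul]

end FastTrackInvolutions

section FastTrackT

variable {n : ℕ}

/-- **Hansen's Lemma 4.3** (sharpened): a nonnegative operator monotone function on `(0, ∞)` with
`f(1) = 1` satisfies `f(t) ≤ t + 1` (indeed `f(t) ≤ max(1, t)`), by monotonicity for `t ≤ 1` and by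
concavity (Theorem 2.1) for `t > 1`. [cite: Hansen2013, Lemma 4.3] -/
theorem le_add_one_of_isMatrixMonotoneOn {f : ℝ → ℝ} (hf : IsMatrixMonotoneOn f (Ioi 0))
    (hpos : ∀ t, 0 < t → 0 ≤ f t) (h1 : f 1 = 1) {t : ℝ} (ht : 0 < t) : f t ≤ t + 1 := by
  have hmono := monotoneOn_of_isMatrixMonotoneOn hf
  rcases le_or_gt t 1 with ht1 | ht1
  · have := hmono ht (show (0 : ℝ) < 1 by norm_num) ht1
    linarith
  · -- concavity between `ε = 1/(t+1)` and `t`, evaluated at `1`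
    have hconc := concaveOn_of_isMatrixMonotoneOn_Ioi hf
    set ε : ℝ := 1 / (t + 1) with hε
    have hεpos : 0 < ε := by rw [hε]; positivity
    have hε1 : ε < 1 := by rw [hε, div_lt_one (by linarith)]; linarith
    set a : ℝ := (t - 1) / (t - ε) with ha
    set b : ℝ := (1 - ε) / (t - ε) with hb
    have htε : 0 < t - ε := by linarith
    have ha0 : 0 ≤ a := by rw [ha]; exact div_nonneg (by linarith) htε.le
    have hb0 : 0 ≤ b := by rw [hb]; exact div_nonneg (by linarith) htε.le
    have hab : a + b = 1 := by rw [ha, hb]; field_simp; ring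
    have hcomb : a * ε + b * t = 1 := by rw [ha, hb]; field_simp; ring
    have h := hconc.2 hεpos ht ha0 hb0 hab
    simp only [smul_eq_mul] at h
    rw [hcomb, h1] at h
    -- `1 ≥ a f(ε) + b f(t) ≥ b f(t)`, i.e. `f(t) ≤ (t - ε)/(1 - ε) ≤ t + 1`
    have hfε := hpos ε hεpos
    have hbt : b * f t ≤ 1 := by nlinarith
    have hb' : 0 < b := by rw [hb]; exact div_pos (by linarith) htε
    have hft : f t ≤ (t - ε) / (1 - ε) := by
      rw [le_div_iff₀ (by linarith), mul_comm]
      have h' := hbt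
      rw [hb, div_mul_eq_mul_div, div_le_one htε] at h'
      exact h'
    have hbound : (t - ε) / (1 - ε) ≤ t + 1 := by
      rw [div_le_iff₀ (by linarith), hε]
      field_simp
      nlinarith
    linarith

/-- The derivative of an operator monotone function on `(0, ∞)` is nonnegative. [folklore] -/
theorem deriv_nonneg_of_isMatrixMonotoneOn {f : ℝ → ℝ} (hf : IsMatrixMonotoneOn f (Ioi 0))
    {t : ℝ} (ht : 0 < t) : 0 ≤ deriv f t := by
  have hmono := monotoneOn_of_isMatrixMonotoneOn hf
  have hd := hasDerivAt_of_isMatrixMonotoneOn_Ioi hf ht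
  rw [hasDerivAt_iff_tendsto_slope] at hd
  have hd' : Tendsto (slope f t) (𝓝[>] t) (𝓝 (deriv f t)) :=
    hd.mono_left (nhdsWithin_mono _ fun s hs => ne_of_gt hs)
  refine ge_of_tendsto hd' ?_
  filter_upwards [self_mem_nhdsWithin] with s hs
  have hs' : t < s := hs
  rw [slope_def_field]
  exact div_nonneg (by linarith [hmono ht (ht.trans hs') hs'.le]) (by linarith)

/-- A non-constant operator monotone function on `(0, ∞)` has positive derivative everywhere
(Hansen's Corollary 3.10). [cite: Hansen2013, Corollary 3.10] -/
theorem deriv_pos_of_isMatrixMonotoneOn {f : ℝ → ℝ} (hf : IsMatrixMonotoneOn f (Ioi 0))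
    (hnc : ∃ s₁ s₂ : ℝ, 0 < s₁ ∧ 0 < s₂ ∧ f s₁ ≠ f s₂) {t : ℝ} (ht : 0 < t) : 0 < deriv f t := by
  refine (deriv_nonneg_of_isMatrixMonotoneOn hf ht).lt_of_ne fun h0 => ?_
  obtain ⟨s₁, s₂, hs₁, hs₂, hne⟩ := hnc
  exact hne ((eq_of_deriv_eq_zero_of_isMatrixMonotoneOn_Ioi hf ht h0.symm hs₁).trans
    (eq_of_deriv_eq_zero_of_isMatrixMonotoneOn_Ioi hf ht h0.symm hs₂).symm)

/-- A non-constant operator monotone function on `(0, ∞)` is strictly increasing. [cite: Hansen2013, §4] -/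
theorem strictMonoOn_of_isMatrixMonotoneOn {f : ℝ → ℝ} (hf : IsMatrixMonotoneOn f (Ioi 0))
    (hnc : ∃ s₁ s₂ : ℝ, 0 < s₁ ∧ 0 < s₂ ∧ f s₁ ≠ f s₂) : StrictMonoOn f (Ioi 0) := by
  have hmono := monotoneOn_of_isMatrixMonotoneOn hf
  intro s hs t ht hst
  have hs' : 0 < s := hs
  refine (hmono hs ht hst.le).lt_of_ne fun heq => ?_
  -- `f` is constant on `[s, t]`, hence has derivative zero at the midpoint
  set u : ℝ := (s + t) / 2 with hu
  have hu0 : 0 < u := by rw [hu]; linarith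
  have hconst : ∀ x ∈ Ioo s t, f x = f s := fun x hx =>
    le_antisymm (by rw [heq]; exact hmono (hs'.trans hx.1) ht hx.2.le) (hmono hs (hs'.trans hx.1) hx.1.le)
  have hderiv : HasDerivAt f 0 u := by
    refine (hasDerivAt_const u (f s)).congr_of_eventuallyEq ?_
    filter_upwards [Ioo_mem_nhds (show s < u by rw [hu]; linarith) (show u < t by rw [hu]; linarith)]
      with x hx
    exact hconst x hx
  have := deriv_pos_of_isMatrixMonotoneOn hf hnc hu0
  rw [hderiv.deriv] at this
  exact lt_irrefl _ this

/-- **Hansen's Theorem 4.4** (reduction to positive functions), monotonicity part: for a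
non-constant operator monotone `f` on `(0, ∞)` the transform
`(T f)(t) = t (f(t) - f(1)) / (f'(1)(t - 1))` (`= 1` at `t = 1`) is operator monotone on
`(0, ∞)`. Proof as printed: `h₁ = [1, ·]_f / f'(1)` is operator decreasing (Bendat–Sherman),
`h₂ = h₁ ∘ (1/t)` is operator monotone and positive, and `T f = h₂*`. [cite: Hansen2013, Theorem 4.4] -/
theorem isMatrixMonotoneOn_hansenT {f : ℝ → ℝ} (hf : IsMatrixMonotoneOn f (Ioi 0))
    (hnc : ∃ s₁ s₂ : ℝ, 0 < s₁ ∧ 0 < s₂ ∧ f s₁ ≠ f s₂) :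
    IsMatrixMonotoneOn
      (fun t => if t = 1 then 1 else t * (f t - f 1) / (deriv f 1 * (t - 1))) (Ioi 0) := by
  have hstrict := strictMonoOn_of_isMatrixMonotoneOn hf hnc
  obtain ⟨c, hc', hBS⟩ := exists_hasDerivAt_dividedDiff_antitone hf one_pos
  have hcd : deriv f 1 = c := hc'.deriv
  have hc : 0 < c := hcd ▸ deriv_pos_of_isMatrixMonotoneOn hf hnc one_pos
  have h1mem : (1 : ℝ) ∈ Ioi 0 := Set.mem_Ioi.mpr one_pos
  -- `h₁ = [1, ·]_f / f'(1)` is operator decreasing and positive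
  set h₁ : ℝ → ℝ := fun t => (if t = 1 then c else slope f 1 t) / c with hh₁
  have hh₁m : IsMatrixMonotoneOn (fun t => -h₁ t) (Ioi 0) := by
    have := isMatrixMonotoneOn_const_mul (inv_pos.mpr hc).le hBS
    refine isMatrixMonotoneOn_congr (fun t _ => ?_) this
    rw [hh₁]; dsimp only
    rw [div_eq_inv_mul, mul_neg]
  have hh₁pos : ∀ t, 0 < t → 0 < h₁ t := by
    intro t ht
    rw [hh₁]; dsimp only
    refine div_pos ?_ hc
    have htm : t ∈ Ioi 0 := ht
    split_ifs with h
    · exact hc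
    · rcases lt_or_gt_of_ne h with hlt | hgt
      · rw [slope_def_field]
        have := hstrict htm h1mem hlt
        exact div_pos_of_neg_of_neg (by linarith) (by linarith)
      · rw [slope_def_field]
        have := hstrict h1mem htm hgt
        exact div_pos (by linarith) (by linarith)
  -- `h₂ = h₁ ∘ (1/t)` is operator monotone and positive; `T f = h₂*`
  have hh₂m : IsMatrixMonotoneOn (fun t => h₁ t⁻¹) (Ioi 0) := isMatrixMonotoneOn_comp_inv_of_neg hh₁m
  have hT := isMatrixMonotoneOn_star hh₂m fun t ht => hh₁pos _ (inv_pos.mpr ht)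
  refine isMatrixMonotoneOn_congr (fun t ht => ?_) hT
  have ht' : (0 : ℝ) < t := ht
  have ht0 : t ≠ 0 := ht'.ne'
  simp only [inv_inv, hh₁, hcd]
  split_ifs with h
  · subst h; field_simp
  · have ht1 : t - 1 ≠ 0 := sub_ne_zero.mpr h
    rw [slope_def_field]
    field_simp

/-- **Hansen's Theorem 4.4**, the identity `f(t) = f(1) + f'(1) (t - 1)/t · (T f)(t)`.
[cite: Hansen2013, Theorem 4.4] -/
theorem hansenT_identity {f : ℝ → ℝ} (hc : deriv f 1 ≠ 0) {t : ℝ} (ht : 0 < t) :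
    f t = f 1 + deriv f 1 * ((t - 1) / t) *
      (if t = 1 then 1 else t * (f t - f 1) / (deriv f 1 * (t - 1))) := by
  split_ifs with h
  · subst h; simp
  · have ht' : t ≠ 0 := ne_of_gt ht
    have ht1 : t - 1 ≠ 0 := sub_ne_zero.mpr h
    field_simp
    ring

/-- **Hansen's Theorem 4.4**, positivity and normalisation of `T f`. [cite: Hansen2013, Theorem 4.4] -/
theorem hansenT_pos {f : ℝ → ℝ} (hf : IsMatrixMonotoneOn f (Ioi 0))
    (hnc : ∃ s₁ s₂ : ℝ, 0 < s₁ ∧ 0 < s₂ ∧ f s₁ ≠ f s₂) {t : ℝ} (ht : 0 < t) :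
    0 < (if t = 1 then 1 else t * (f t - f 1) / (deriv f 1 * (t - 1))) := by
  have hc : 0 < deriv f 1 := deriv_pos_of_isMatrixMonotoneOn hf hnc one_pos
  have hstrict := strictMonoOn_of_isMatrixMonotoneOn hf hnc
  have h1mem : (1 : ℝ) ∈ Ioi 0 := Set.mem_Ioi.mpr one_pos
  have htm : t ∈ Ioi 0 := ht
  split_ifs with h
  · exact one_pos
  · rcases lt_or_gt_of_ne h with hlt | hgt
    · have h1 : f t - f 1 < 0 := by linarith [hstrict htm h1mem hlt]
      have h2 : deriv f 1 * (t - 1) < 0 := mul_neg_of_pos_of_neg hc (by linarith)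
      exact div_pos_of_neg_of_neg (mul_neg_of_pos_of_neg ht h1) h2
    · have h1 : 0 < f t - f 1 := by linarith [hstrict h1mem htm hgt]
      exact div_pos (mul_pos ht h1) (mul_pos hc (by linarith))

/-- **Hansen's Lemma 4.6** (derivative of the involution `*`): `(f*)'(1) = f(1) - f'(1)` for
`f*(t) = t f(1/t)`. [cite: Hansen2013, Lemma 4.6] -/
theorem hasDerivAt_star_one {f : ℝ → ℝ} {c : ℝ} (hf : HasDerivAt f c 1) :
    HasDerivAt (fun t => t * f t⁻¹) (f 1 - c) 1 := by
  have hinv : HasDerivAt (fun t : ℝ => t⁻¹) (-1) 1 := by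
    simpa using hasDerivAt_inv (one_ne_zero (α := ℝ))
  have hcomp : HasDerivAt (fun t => f t⁻¹) (c * -1) 1 := by
    have hf' : HasDerivAt f c (1 : ℝ)⁻¹ := by simpa using hf
    exact hf'.comp 1 hinv
  have h : HasDerivAt (fun t : ℝ => id t * f t⁻¹) (1 * f (1 : ℝ)⁻¹ + id (1 : ℝ) * (c * -1)) 1 :=
    (hasDerivAt_id 1).mul hcomp
  have e : (1 : ℝ) * f (1 : ℝ)⁻¹ + id (1 : ℝ) * (c * -1) = f 1 - c := by
    rw [inv_one, id_eq]; ring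
  rw [e] at h
  exact h

end FastTrackT

section NormalisedClass

/-! Hansen's compact convex class `𝒫₀` of positive normalised operator monotone functions on
`(0, ∞)` is realised inside `ℝ → ℝ` (functions extended by `0` on `(-∞, 0]`) as the set
`{g | IsMatrixMonotoneOn g (Ioi 0) ∧ (∀ t, 0 < t → 0 ≤ g t) ∧ g 1 = 1 ∧ ∀ t, t ≤ 0 → g t = 0}`,
written out at each use (this file introduces no definitions or notation). -/

/-- Elements of `𝒫₀` are strictly positive on `(0, ∞)` (nonnegative, increasing, `g(1) = 1`, and a
zero would force `g` to be constant by Corollary 3.10). [cite: Hansen2013, §4] -/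
theorem pos_of_normalised {g : ℝ → ℝ} (hg : IsMatrixMonotoneOn g (Ioi 0))
    (hg0 : ∀ t, 0 < t → 0 ≤ g t) (hg1 : g 1 = 1) {t : ℝ} (ht : 0 < t) : 0 < g t := by
  have hmono := monotoneOn_of_isMatrixMonotoneOn hg
  refine (hg0 t ht).lt_of_ne fun h0 => ?_
  -- `g = 0` on `(0, t]`, so `g' (t/2) = 0` and `g` is constant, contradicting `g 1 = 1`
  have hzero : ∀ s ∈ Ioo 0 t, g s = 0 := fun s hs =>
    le_antisymm (h0 ▸ hmono hs.1 ht hs.2.le) (hg0 s hs.1)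
  have hderiv : HasDerivAt g 0 (t / 2) := by
    refine (hasDerivAt_const (t / 2) (0 : ℝ)).congr_of_eventuallyEq ?_
    filter_upwards [Ioo_mem_nhds (show 0 < t / 2 by linarith) (show t / 2 < t by linarith)]
      with s hs
    exact hzero s hs
  have h1 := eq_of_deriv_eq_zero_of_isMatrixMonotoneOn_Ioi hg (by linarith : 0 < t / 2)
    hderiv.deriv one_pos
  rw [hg1, hzero (t / 2) ⟨by linarith, by linarith⟩] at h1
  exact one_ne_zero h1

/-- `𝒫₀` is stable under the involution `g ↦ g*`, `g*(t) = t g(1/t)`. [cite: Hansen2013, Lemma 4.5] -/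
theorem star_mem_normalised {g : ℝ → ℝ} (hg : g ∈ {g : ℝ → ℝ | IsMatrixMonotoneOn g (Ioi 0) ∧ (∀ t, 0 < t → 0 ≤ g t) ∧
      g 1 = 1 ∧ ∀ t, t ≤ 0 → g t = 0}) :
    (fun t => if 0 < t then t * g t⁻¹ else 0) ∈ {g : ℝ → ℝ | IsMatrixMonotoneOn g (Ioi 0) ∧ (∀ t, 0 < t → 0 ≤ g t) ∧
      g 1 = 1 ∧ ∀ t, t ≤ 0 → g t = 0} := by
  obtain ⟨hgm, hg0, hg1, -⟩ := hg
  have hpos : ∀ t, 0 < t → 0 < g t := fun t ht => pos_of_normalised hgm hg0 hg1 ht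
  refine ⟨?_, fun t ht => ?_, ?_, fun t ht => ?_⟩
  · refine isMatrixMonotoneOn_congr (fun t ht => ?_) (isMatrixMonotoneOn_star hgm hpos)
    have ht' : 0 < t := ht
    simp [ht']
  · simp only [ht, if_true]
    exact (mul_pos ht (hpos _ (inv_pos.mpr ht))).le
  · simp [hg1]
  · simp [not_lt.mpr ht]

/-- `𝒫₀` is stable under Hansen's transform `T` (for non-constant elements).
[cite: Hansen2013, Lemma 4.5] -/
theorem hansenT_mem_normalised {g : ℝ → ℝ} (hgm : IsMatrixMonotoneOn g (Ioi 0))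
    (hnc : ∃ s₁ s₂ : ℝ, 0 < s₁ ∧ 0 < s₂ ∧ g s₁ ≠ g s₂) :
    (fun t => if 0 < t then (if t = 1 then 1 else t * (g t - g 1) / (deriv g 1 * (t - 1)))
      else 0) ∈ {g : ℝ → ℝ | IsMatrixMonotoneOn g (Ioi 0) ∧ (∀ t, 0 < t → 0 ≤ g t) ∧
      g 1 = 1 ∧ ∀ t, t ≤ 0 → g t = 0} := by
  refine ⟨?_, fun t ht => ?_, ?_, fun t ht => ?_⟩
  · refine isMatrixMonotoneOn_congr (fun t ht => ?_) (isMatrixMonotoneOn_hansenT hgm hnc)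
    have ht' : 0 < t := ht
    simp only [ht', if_true]
  · simp only [ht, if_true]
    exact (hansenT_pos hgm hnc ht).le
  · simp
  · simp [not_lt.mpr ht]

/-- The derivative at `1` of `g*` for `g ∈ 𝒫₀`: `(g*)'(1) = 1 - g'(1)` (Hansen's Lemma 4.6).
[cite: Hansen2013, Lemma 4.6] -/
theorem hasDerivAt_star_normalised {g : ℝ → ℝ} (hg : IsMatrixMonotoneOn g (Ioi 0)) (hg1 : g 1 = 1) :
    HasDerivAt (fun t => if 0 < t then t * g t⁻¹ else 0) (1 - deriv g 1) 1 := by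
  have h := hasDerivAt_star_one (hasDerivAt_of_isMatrixMonotoneOn_Ioi hg one_pos)
  rw [hg1] at h
  refine h.congr_of_eventuallyEq ?_
  filter_upwards [Ioi_mem_nhds (show (0 : ℝ) < 1 from one_pos)] with t ht
  have ht' : 0 < t := ht
  simp [ht']

/-- For `g ∈ 𝒫₀` the derivative at `1` lies in `[0, 1]` (Hansen's Lemma 4.6 / Corollary 4.7).
[cite: Hansen2013, Corollary 4.7] -/
theorem deriv_one_mem_Icc_of_normalised {g : ℝ → ℝ} (hg : g ∈ {g : ℝ → ℝ | IsMatrixMonotoneOn g (Ioi 0) ∧ (∀ t, 0 < t → 0 ≤ g t) ∧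
      g 1 = 1 ∧ ∀ t, t ≤ 0 → g t = 0}) : deriv g 1 ∈ Icc (0 : ℝ) 1 := by
  have hstar := star_mem_normalised hg
  obtain ⟨hgm, hg0, hg1, -⟩ := hg
  refine ⟨deriv_nonneg_of_isMatrixMonotoneOn hgm one_pos, ?_⟩
  have h := deriv_nonneg_of_isMatrixMonotoneOn hstar.1 one_pos
  rw [(hasDerivAt_star_normalised hgm hg1).deriv] at h
  linarith

/-- **Hansen's Lemma 4.8**: the extreme points of `𝒫₀` are among the functions
`t ↦ t / (λ + (1 - λ)t)`, `λ ∈ [0, 1]`. Proof as printed: with `λ = g'(1)`,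
`g = λ T g + (1 - λ) (T g*)*` exhibits `g` as a convex combination inside `𝒫₀`; the degenerate
cases `λ ∈ {0, 1}` are the constant `1` and the identity (Corollary 3.10). [cite: Hansen2013, Lemma 4.8] -/
theorem extremePoints_normalised_subset {g : ℝ → ℝ} (hext : g ∈ extremePoints ℝ {g : ℝ → ℝ | IsMatrixMonotoneOn g (Ioi 0) ∧ (∀ t, 0 < t → 0 ≤ g t) ∧
      g 1 = 1 ∧ ∀ t, t ≤ 0 → g t = 0}) :
    ∃ l ∈ Icc (0 : ℝ) 1, ∀ t, 0 < t → g t = t / (l + (1 - l) * t) := by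
  rw [mem_extremePoints] at hext
  obtain ⟨hg, hext⟩ := hext
  by_cases hconst : ∀ t, 0 < t → g t = 1
  · exact ⟨0, ⟨le_rfl, zero_le_one⟩, fun t ht => by
      rw [hconst t ht, zero_add, sub_zero, one_mul, div_self ht.ne']⟩
  by_cases hid : ∀ t, 0 < t → g t = t
  · exact ⟨1, ⟨zero_le_one, le_rfl⟩, fun t ht => by
      rw [hid t ht, sub_self, zero_mul, add_zero, div_one]⟩
  -- the generic case `0 < λ < 1`
  have hgS := hg
  obtain ⟨hgm, hg0, hg1, hgz⟩ := hg
  have hpos : ∀ t, 0 < t → 0 < g t := fun t ht => pos_of_normalised hgm hg0 hg1 ht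
  have hnc : ∃ s₁ s₂ : ℝ, 0 < s₁ ∧ 0 < s₂ ∧ g s₁ ≠ g s₂ := by
    push Not at hconst
    obtain ⟨t, ht, hne⟩ := hconst
    exact ⟨t, 1, ht, one_pos, by rwa [hg1]⟩
  set gs : ℝ → ℝ := fun t => if 0 < t then t * g t⁻¹ else 0 with hgs
  have hgsS : gs ∈ {g : ℝ → ℝ | IsMatrixMonotoneOn g (Ioi 0) ∧ (∀ t, 0 < t → 0 ≤ g t) ∧
      g 1 = 1 ∧ ∀ t, t ≤ 0 → g t = 0} := star_mem_normalised hgS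
  have hgs_nc : ∃ s₁ s₂ : ℝ, 0 < s₁ ∧ 0 < s₂ ∧ gs s₁ ≠ gs s₂ := by
    push Not at hid
    obtain ⟨t, ht, hne⟩ := hid
    refine ⟨t⁻¹, 1, inv_pos.mpr ht, one_pos, ?_⟩
    rw [hgs]; dsimp only
    rw [if_pos (inv_pos.mpr ht), if_pos one_pos, inv_inv, inv_one, hg1, one_mul]
    intro h
    apply hne
    rw [inv_mul_eq_one₀ ht.ne'] at h
    exact h.symm
  set L : ℝ := deriv g 1 with hL
  have hLpos : 0 < L := deriv_pos_of_isMatrixMonotoneOn hgm hnc one_pos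
  have hgs_deriv : deriv gs 1 = 1 - L := (hasDerivAt_star_normalised hgm hg1).deriv
  have hL1 : L < 1 := by
    have := deriv_pos_of_isMatrixMonotoneOn hgsS.1 hgs_nc one_pos
    rw [hgs_deriv] at this; linarith
  -- the two functions of the decomposition
  set g₁ : ℝ → ℝ := fun t => if 0 < t then
    (if t = 1 then 1 else t * (g t - g 1) / (deriv g 1 * (t - 1))) else 0 with hg₁
  set Tgs : ℝ → ℝ := fun t => if 0 < t then
    (if t = 1 then 1 else t * (gs t - gs 1) / (deriv gs 1 * (t - 1))) else 0 with hTgs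
  set g₂ : ℝ → ℝ := fun t => if 0 < t then t * Tgs t⁻¹ else 0 with hg₂
  have hg₁S : g₁ ∈ {g : ℝ → ℝ | IsMatrixMonotoneOn g (Ioi 0) ∧ (∀ t, 0 < t → 0 ≤ g t) ∧
      g 1 = 1 ∧ ∀ t, t ≤ 0 → g t = 0} := hansenT_mem_normalised hgm hnc
  have hTgsS : Tgs ∈ {g : ℝ → ℝ | IsMatrixMonotoneOn g (Ioi 0) ∧ (∀ t, 0 < t → 0 ≤ g t) ∧
      g 1 = 1 ∧ ∀ t, t ≤ 0 → g t = 0} := hansenT_mem_normalised hgsS.1 hgs_nc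
  have hg₂S : g₂ ∈ {g : ℝ → ℝ | IsMatrixMonotoneOn g (Ioi 0) ∧ (∀ t, 0 < t → 0 ≤ g t) ∧
      g 1 = 1 ∧ ∀ t, t ≤ 0 → g t = 0} := star_mem_normalised hTgsS
  -- the identity `g = λ g₁ + (1 - λ) g₂`
  have hgs1 : gs 1 = 1 := hgsS.2.2.1
  have hdecomp : L • g₁ + (1 - L) • g₂ = g := by
    funext t
    simp only [Pi.add_apply, Pi.smul_apply, smul_eq_mul]
    by_cases ht : 0 < t
    · rw [hg₁, hg₂]; dsimp only
      rw [if_pos ht, if_pos ht, hTgs]; dsimp only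
      rw [if_pos (inv_pos.mpr ht), hgs_deriv, hgs1, hg1]
      by_cases ht1 : t = 1
      · subst ht1
        rw [if_pos rfl, inv_one, if_pos rfl, hg1]
        ring
      · have ht1' : t⁻¹ ≠ 1 := fun h => ht1 (by simpa using congrArg (·⁻¹) h)
        rw [if_neg ht1, if_neg ht1', hgs]; dsimp only
        rw [if_pos (inv_pos.mpr ht), inv_inv, ← hL]
        have h1 : t - 1 ≠ 0 := sub_ne_zero.mpr ht1
        have h2 : t⁻¹ - 1 ≠ 0 := sub_ne_zero.mpr ht1'
        have h3 : (1 - L) ≠ 0 := by linarith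
        have h4 : t ≠ 0 := ht.ne'
        field_simp
        ring
    · rw [hg₁, hg₂]; dsimp only
      rw [if_neg ht, if_neg ht, hgz t (not_lt.mp ht)]
      ring
  -- extremality forces `g₁ = g`
  have hseg : g ∈ openSegment ℝ g₁ g₂ := ⟨L, 1 - L, hLpos, by linarith, by ring, hdecomp⟩
  have heq : g₁ = g := (hext g₁ hg₁S g₂ hg₂S hseg).1
  refine ⟨L, ⟨hLpos.le, hL1.le⟩, fun t ht => ?_⟩
  have hden : 0 < L + (1 - L) * t := by nlinarith
  by_cases ht1 : t = 1
  · subst ht1; rw [hg1, eq_div_iff hden.ne']; ring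
  · have h := congrFun heq t
    rw [hg₁] at h; dsimp only at h
    rw [if_pos ht, if_neg ht1, hg1, ← hL] at h
    have h1 : t - 1 ≠ 0 := sub_ne_zero.mpr ht1
    rw [eq_div_iff hden.ne']
    rw [div_eq_iff (mul_ne_zero hLpos.ne' h1)] at h
    linear_combination h

end NormalisedClass

section KreinMilmanRepresentation

open MeasureTheory
open scoped CompactlySupported

/-- Matrix monotonicity is a closed condition in the topology of pointwise convergence (it is an
intersection of closed half-spaces given by the spectral quadratic forms). [cite: Hansen2013, §4] -/
theorem isClosed_setOf_isMatrixMonotoneOn (Δ : Set ℝ) :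
    IsClosed {g : ℝ → ℝ | IsMatrixMonotoneOn g Δ} := by
  have key : {g : ℝ → ℝ | IsMatrixMonotoneOn g Δ} = ⋂ (n : ℕ), ⋂ (A : Matrix (Fin n) (Fin n) ℂ),
      ⋂ (B : Matrix (Fin n) (Fin n) ℂ), ⋂ (hA : A.IsHermitian), ⋂ (hB : B.IsHermitian),
      ⋂ (_ : spectrum ℝ A ⊆ Δ), ⋂ (_ : spectrum ℝ B ⊆ Δ), ⋂ (_ : (B - A).PosSemidef), ⋂ v,
      {g : ℝ → ℝ | ∑ i, g (hA.eigenvalues i) *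
          Complex.normSq ((star (hA.eigenvectorUnitary : Matrix (Fin n) (Fin n) ℂ) *ᵥ v) i) ≤
        ∑ i, g (hB.eigenvalues i) *
          Complex.normSq ((star (hB.eigenvectorUnitary : Matrix (Fin n) (Fin n) ℂ) *ᵥ v) i)} := by
    ext g
    simp only [mem_setOf_eq, mem_iInter]
    constructor
    · intro hg n A B hA hB hAs hBs hAB v
      have h := hg n A B hA hB hAs hBs hAB
      rw [← Matrix.le_iff, cfc_le_cfc_iff hA hB] at h
      exact h v
    · intro h n A B hA hB hAs hBs hAB
      rw [← Matrix.le_iff, cfc_le_cfc_iff hA hB]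
      exact fun v => h n A B hA hB hAs hBs hAB v
  rw [key]
  refine isClosed_iInter fun n => isClosed_iInter fun A => isClosed_iInter fun B =>
    isClosed_iInter fun hA => isClosed_iInter fun hB => isClosed_iInter fun _ =>
    isClosed_iInter fun _ => isClosed_iInter fun _ => isClosed_iInter fun v => ?_
  refine isClosed_le ?_ ?_
  · exact continuous_finsetSum _ fun i _ => (continuous_apply _).mul continuous_const
  · exact continuous_finsetSum _ fun i _ => (continuous_apply _).mul continuous_const

/-- `𝒫₀` is convex. [cite: Hansen2013, §4] -/
theorem convex_normalised : Convex ℝ {g : ℝ → ℝ | IsMatrixMonotoneOn g (Ioi 0) ∧ (∀ t, 0 < t → 0 ≤ g t) ∧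
      g 1 = 1 ∧ ∀ t, t ≤ 0 → g t = 0} := by
  intro g₁ hg₁ g₂ hg₂ a b ha hb hab
  obtain ⟨h1m, h10, h11, h1z⟩ := hg₁
  obtain ⟨h2m, h20, h21, h2z⟩ := hg₂
  refine ⟨?_, fun t ht => ?_, ?_, fun t ht => ?_⟩
  · refine isMatrixMonotoneOn_congr (fun t _ => ?_)
      (isMatrixMonotoneOn_add (isMatrixMonotoneOn_const_mul ha h1m)
        (isMatrixMonotoneOn_const_mul hb h2m))
    simp
  · simp only [Pi.add_apply, Pi.smul_apply, smul_eq_mul]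
    exact add_nonneg (mul_nonneg ha (h10 t ht)) (mul_nonneg hb (h20 t ht))
  · simp [h11, h21, hab]
  · simp [h1z t ht, h2z t ht]

/-- `𝒫₀` is closed in the topology of pointwise convergence. [cite: Hansen2013, §4] -/
theorem isClosed_normalised : IsClosed {g : ℝ → ℝ | IsMatrixMonotoneOn g (Ioi 0) ∧ (∀ t, 0 < t → 0 ≤ g t) ∧
      g 1 = 1 ∧ ∀ t, t ≤ 0 → g t = 0} := by
  have key : {g : ℝ → ℝ | IsMatrixMonotoneOn g (Ioi 0) ∧ (∀ t, 0 < t → 0 ≤ g t) ∧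
      g 1 = 1 ∧ ∀ t, t ≤ 0 → g t = 0} = {g : ℝ → ℝ | IsMatrixMonotoneOn g (Ioi 0)} ∩
      (⋂ (t : ℝ) (_ : 0 < t), {g : ℝ → ℝ | 0 ≤ g t}) ∩ {g : ℝ → ℝ | g 1 = 1} ∩
      (⋂ (t : ℝ) (_ : t ≤ 0), {g : ℝ → ℝ | g t = 0}) := by
    ext g
    simp only [mem_setOf_eq, mem_inter_iff, mem_iInter]
    tauto
  rw [key]
  refine ((isClosed_setOf_isMatrixMonotoneOn _).inter ?_).inter (isClosed_eq (continuous_apply 1)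
    continuous_const) |>.inter ?_
  · exact isClosed_iInter fun t => isClosed_iInter fun _ =>
      isClosed_le continuous_const (continuous_apply t)
  · exact isClosed_iInter fun t => isClosed_iInter fun _ =>
      isClosed_eq (continuous_apply t) continuous_const

/-- `𝒫₀` is compact in the topology of pointwise convergence (Tychonoff and Lemma 4.3).
[cite: Hansen2013, Lemma 4.3] -/
theorem isCompact_normalised : IsCompact {g : ℝ → ℝ | IsMatrixMonotoneOn g (Ioi 0) ∧ (∀ t, 0 < t → 0 ≤ g t) ∧
      g 1 = 1 ∧ ∀ t, t ≤ 0 → g t = 0} := by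
  have hbox : IsCompact (Set.pi univ fun t : ℝ => Icc (0 : ℝ) (|t| + 1)) :=
    isCompact_univ_pi fun t => isCompact_Icc
  refine hbox.of_isClosed_subset isClosed_normalised fun g hg => ?_
  obtain ⟨hgm, hg0, hg1, hgz⟩ := hg
  rw [mem_univ_pi]
  intro t
  by_cases ht : 0 < t
  · refine ⟨hg0 t ht, ?_⟩
    have := le_add_one_of_isMatrixMonotoneOn hgm hg0 hg1 ht
    rw [abs_of_pos ht]; exact this
  · rw [hgz t (not_lt.mp ht)]
    exact ⟨le_rfl, by positivity⟩

/-- The denominators `λ + (1 - λ)t` of Hansen's extreme functions are positive for `t > 0`,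
`λ ∈ [0, 1]`. [folklore] -/
theorem hansen_den_pos {l t : ℝ} (hl : l ∈ Icc (0 : ℝ) 1) (ht : 0 < t) : 0 < l + (1 - l) * t := by
  rcases hl.1.lt_or_eq with h0 | h0
  · nlinarith [hl.2]
  · rw [← h0]; simpa using ht

/-- **Hansen's Theorem 4.9** (integral representation of `𝒫₀`): every `g ∈ 𝒫₀` is
`g(t) = ∫₀¹ t / (λ + (1 - λ)t) dμ(λ)` for a finite positive Borel measure `μ` on `[0, 1]` (indeed a
probability measure). Proof as printed — Krein–Milman in the topology of pointwise convergence
(Mathlib's `closure_convexHull_extremePoints`) and Lemma 4.8 — with the passage to the limit of the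
discrete representing measures organised through the weak-* compact set of positive normalised
functionals on `C[0, 1]` (Banach–Alaoglu) and the Riesz–Markov–Kakutani theorem.
[cite: Hansen2013, Theorem 4.9] -/
theorem exists_measure_repr_of_normalised {g : ℝ → ℝ} (hg : g ∈ {g : ℝ → ℝ | IsMatrixMonotoneOn g (Ioi 0) ∧ (∀ t, 0 < t → 0 ≤ g t) ∧
      g 1 = 1 ∧ ∀ t, t ≤ 0 → g t = 0}) :
    ∃ μ : Measure unitInterval, IsFiniteMeasure μ ∧
      ∀ t, 0 < t → g t = ∫ l, t / ((l : ℝ) + (1 - (l : ℝ)) * t) ∂μ := by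
  -- the kernel functions `k_t ∈ C[0,1]`
  have hden : ∀ (l : unitInterval) {t : ℝ}, 0 < t → 0 < (l : ℝ) + (1 - (l : ℝ)) * t :=
    fun l t ht => hansen_den_pos l.2 ht
  set kf : ∀ t : ℝ, 0 < t → C(unitInterval, ℝ) := fun t ht =>
    ⟨fun l => t / ((l : ℝ) + (1 - (l : ℝ)) * t),
      continuous_const.div (by fun_prop) fun l => (hden l ht).ne'⟩ with hkf
  have hkf_apply : ∀ t (ht : 0 < t) (l : unitInterval),
      kf t ht l = t / ((l : ℝ) + (1 - (l : ℝ)) * t) := fun t ht l => rfl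
  -- the compact set of positive normalised functionals and the evaluation map `Φ`
  set K : Set (WeakDual ℝ C(unitInterval, ℝ)) :=
    (WeakDual.toStrongDual ⁻¹' closedBall 0 1) ∩
      ({Λ | ∀ φ : C(unitInterval, ℝ), 0 ≤ φ → 0 ≤ Λ φ} ∩ {Λ | Λ 1 = 1}) with hK
  have hKc : IsCompact K := by
    refine (WeakDual.isCompact_closedBall 0 1).inter_right (IsClosed.inter ?_ ?_)
    · have : {Λ : WeakDual ℝ C(unitInterval, ℝ) | ∀ φ : C(unitInterval, ℝ), 0 ≤ φ → 0 ≤ Λ φ} =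
          ⋂ (φ : C(unitInterval, ℝ)) (_ : 0 ≤ φ), {Λ | 0 ≤ Λ φ} := by
        ext Λ; simp only [mem_setOf_eq, mem_iInter]
      rw [this]
      exact isClosed_iInter fun φ => isClosed_iInter fun _ =>
        isClosed_le continuous_const (WeakDual.eval_continuous φ)
    · exact isClosed_eq (WeakDual.eval_continuous _) continuous_const
  set Φ : WeakDual ℝ C(unitInterval, ℝ) → (ℝ → ℝ) := fun Λ t =>
    if ht : 0 < t then Λ (kf t ht) else 0 with hΦ
  have hΦc : Continuous Φ := by
    refine continuous_pi fun t => ?_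
    by_cases ht : 0 < t
    · simp only [hΦ, dif_pos ht]
      exact WeakDual.eval_continuous _
    · simp only [hΦ, dif_neg ht]
      exact continuous_const
  have hclosed : IsClosed (Φ '' K) := (hKc.image hΦc).isClosed
  -- `Φ '' K` is convex
  have hconvK : Convex ℝ (Φ '' K) := by
    rintro _ ⟨Λ₁, hΛ₁, rfl⟩ _ ⟨Λ₂, hΛ₂, rfl⟩ a b ha hb hab
    refine ⟨a • Λ₁ + b • Λ₂, ?_, ?_⟩
    · obtain ⟨h1n, h1p, h11⟩ := hΛ₁
      obtain ⟨h2n, h2p, h21⟩ := hΛ₂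
      refine ⟨?_, fun φ hφ => ?_, ?_⟩
      · have h1n' : ‖WeakDual.toStrongDual Λ₁‖ ≤ 1 :=
          (mem_closedBall_zero_iff (E := StrongDual ℝ C(unitInterval, ℝ))).mp h1n
        have h2n' : ‖WeakDual.toStrongDual Λ₂‖ ≤ 1 :=
          (mem_closedBall_zero_iff (E := StrongDual ℝ C(unitInterval, ℝ))).mp h2n
        show WeakDual.toStrongDual (a • Λ₁ + b • Λ₂) ∈ closedBall 0 1
        refine (mem_closedBall_zero_iff (E := StrongDual ℝ C(unitInterval, ℝ))).mpr ?_
        refine ContinuousLinearMap.opNorm_le_bound _ zero_le_one fun φ => ?_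
        change ‖a * Λ₁ φ + b * Λ₂ φ‖ ≤ 1 * ‖φ‖
        have e1 : ‖Λ₁ φ‖ ≤ 1 * ‖φ‖ := (WeakDual.toStrongDual Λ₁).le_of_opNorm_le h1n' φ
        have e2 : ‖Λ₂ φ‖ ≤ 1 * ‖φ‖ := (WeakDual.toStrongDual Λ₂).le_of_opNorm_le h2n' φ
        rw [Real.norm_eq_abs] at e1 e2 ⊢
        calc |a * Λ₁ φ + b * Λ₂ φ| ≤ |a * Λ₁ φ| + |b * Λ₂ φ| := abs_add_le _ _
          _ = a * |Λ₁ φ| + b * |Λ₂ φ| := by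
              rw [abs_mul, abs_mul, abs_of_nonneg ha, abs_of_nonneg hb]
          _ ≤ a * (1 * ‖φ‖) + b * (1 * ‖φ‖) := by gcongr
          _ = 1 * ‖φ‖ := by rw [← add_mul, hab, one_mul]
      · change 0 ≤ a * Λ₁ φ + b * Λ₂ φ
        exact add_nonneg (mul_nonneg ha (h1p φ hφ)) (mul_nonneg hb (h2p φ hφ))
      · have e1 : Λ₁ 1 = 1 := h11
        have e2 : Λ₂ 1 = 1 := h21
        change a * Λ₁ 1 + b * Λ₂ 1 = 1
        rw [e1, e2, mul_one, mul_one, hab]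
    · funext t
      simp only [hΦ, Pi.add_apply, Pi.smul_apply, smul_eq_mul]
      by_cases ht : 0 < t
      · simp only [dif_pos ht]
        rfl
      · simp only [dif_neg ht, mul_zero, add_zero]
  -- the extreme points of `𝒫₀` lie in `Φ '' K` (Lemma 4.8 and point evaluations)
  have hext : extremePoints ℝ {g : ℝ → ℝ | IsMatrixMonotoneOn g (Ioi 0) ∧ (∀ t, 0 < t → 0 ≤ g t) ∧
      g 1 = 1 ∧ ∀ t, t ≤ 0 → g t = 0} ⊆ Φ '' K := by
    intro e he
    have heS : e ∈ {g : ℝ → ℝ | IsMatrixMonotoneOn g (Ioi 0) ∧ (∀ t, 0 < t → 0 ≤ g t) ∧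
      g 1 = 1 ∧ ∀ t, t ≤ 0 → g t = 0} := extremePoints_subset he
    obtain ⟨l, hl, hel⟩ := extremePoints_normalised_subset he
    -- the point evaluation at `l`
    set δₗ : C(unitInterval, ℝ) →ₗ[ℝ] ℝ :=
      { toFun := fun φ => φ ⟨l, hl⟩
        map_add' := fun _ _ => rfl
        map_smul' := fun _ _ => rfl } with hδₗ
    have hδb : ∀ φ, ‖δₗ φ‖ ≤ 1 * ‖φ‖ := fun φ => by
      rw [one_mul]; exact φ.norm_coe_le_norm ⟨l, hl⟩
    set δ : StrongDual ℝ C(unitInterval, ℝ) := δₗ.mkContinuous 1 hδb with hδ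
    have hδ_apply : ∀ φ, δ φ = φ ⟨l, hl⟩ := fun φ => rfl
    refine ⟨StrongDual.toWeakDual δ, ⟨?_, fun φ hφ => ?_, ?_⟩, ?_⟩
    · show WeakDual.toStrongDual (StrongDual.toWeakDual δ) ∈ closedBall 0 1
      exact (mem_closedBall_zero_iff (E := StrongDual ℝ C(unitInterval, ℝ))).mpr
        (δₗ.mkContinuous_norm_le zero_le_one hδb)
    · show 0 ≤ δ φ
      rw [hδ_apply]; exact hφ _
    · show δ 1 = 1
      rw [hδ_apply]; rfl
    · funext t
      simp only [hΦ]
      by_cases ht : 0 < t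
      · rw [dif_pos ht, hel t ht]
        show δ (kf t ht) = _
        rw [hδ_apply, hkf_apply t ht]
      · rw [dif_neg ht, heS.2.2.2 t (not_lt.mp ht)]
  -- Krein–Milman
  have hKM := closure_convexHull_extremePoints isCompact_normalised convex_normalised
  have hsub : {g : ℝ → ℝ | IsMatrixMonotoneOn g (Ioi 0) ∧ (∀ t, 0 < t → 0 ≤ g t) ∧
      g 1 = 1 ∧ ∀ t, t ≤ 0 → g t = 0} ⊆ Φ '' K := by
    rw [← hKM]
    exact closure_minimal (convexHull_min hext hconvK) hclosed
  obtain ⟨Λ, ⟨-, hΛpos, hΛ1⟩, hΛg⟩ := hsub hg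
  -- the Riesz–Markov–Kakutani measure of `Λ`
  set Λₗ : C_c(unitInterval, ℝ) →ₗ[ℝ] ℝ :=
    { toFun := fun f => Λ f.toContinuousMap
      map_add' := by
        intro f₁ f₂
        have : (f₁ + f₂).toContinuousMap = f₁.toContinuousMap + f₂.toContinuousMap := by
          ext; rfl
        rw [this, map_add]
      map_smul' := by
        intro a f
        have : (a • f).toContinuousMap = a • f.toContinuousMap := by
          ext; rfl
        rw [this, map_smul]
        rfl } with hΛₗ
  have hΛₗ_apply : ∀ f, Λₗ f = Λ f.toContinuousMap := fun f => rfl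
  set Λp : C_c(unitInterval, ℝ) →ₚ[ℝ] ℝ := PositiveLinearMap.mk₀ Λₗ (by
    intro f hf
    rw [hΛₗ_apply]
    apply hΛpos
    intro x
    exact hf x) with hΛp
  have hΛp_apply : ∀ f, Λp f = Λ f.toContinuousMap := fun f => rfl
  set μ : Measure unitInterval := RealRMK.rieszMeasure Λp with hμ
  have hμint : ∀ φ : C(unitInterval, ℝ), ∫ l, φ l ∂μ = Λ φ := by
    intro φ
    have h := RealRMK.integral_rieszMeasure Λp ⟨φ, HasCompactSupport.of_compactSpace φ⟩
    rw [hΛp_apply] at h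
    exact h
  refine ⟨μ, inferInstance, fun t ht => ?_⟩
  have h1 : g t = Λ (kf t ht) := by
    have := congrFun hΛg t
    simp only [hΦ, dif_pos ht] at this
    exact this.symm
  rw [h1, ← hμint]
  rfl

end KreinMilmanRepresentation

section PickExtensionHalfLine

open MeasureTheory
open scoped CompactlySupported

/-- **Integral representation of operator monotone functions on `(0, ∞)`** (Hansen 2013,
Theorems 4.4 and 4.9 combined; cf. Theorem 5.2): a non-constant operator monotone `f` satisfies
`f(t) = f(1) + f'(1) ∫₀¹ (t - 1)/(λ + (1 - λ)t) dμ(λ)` for a finite positive measure `μ` on `[0, 1]`.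
[cite: Hansen2013, Theorem 4.9] -/
theorem exists_measure_repr_of_isMatrixMonotoneOn {f : ℝ → ℝ} (hf : IsMatrixMonotoneOn f (Ioi 0))
    (hnc : ∃ s₁ s₂ : ℝ, 0 < s₁ ∧ 0 < s₂ ∧ f s₁ ≠ f s₂) :
    ∃ μ : Measure unitInterval, IsFiniteMeasure μ ∧
      ∀ t, 0 < t → f t = f 1 + deriv f 1 * ∫ l, (t - 1) / ((l : ℝ) + (1 - (l : ℝ)) * t) ∂μ := by
  have hT : (fun t => if 0 < t then (if t = 1 then 1 else t * (f t - f 1) / (deriv f 1 * (t - 1)))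
      else 0) ∈ {g : ℝ → ℝ | IsMatrixMonotoneOn g (Ioi 0) ∧ (∀ t, 0 < t → 0 ≤ g t) ∧
      g 1 = 1 ∧ ∀ t, t ≤ 0 → g t = 0} := hansenT_mem_normalised hf hnc
  obtain ⟨μ, hμ, hrep⟩ := exists_measure_repr_of_normalised hT
  have hc : deriv f 1 ≠ 0 := (deriv_pos_of_isMatrixMonotoneOn hf hnc one_pos).ne'
  refine ⟨μ, hμ, fun t ht => ?_⟩
  have h1 := hansenT_identity (f := f) hc ht
  have h2 := hrep t ht
  simp only [if_pos ht] at h2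
  rw [h2] at h1
  rw [h1, mul_assoc, ← integral_const_mul]
  congr 2
  refine integral_congr_ae (Eventually.of_forall fun l => ?_)
  have hden := hansen_den_pos l.2 ht
  have ht' : t ≠ 0 := ht.ne'
  field_simp

/-- The denominators `λ + (1 - λ)z` of Hansen's kernel do not vanish on the slit plane
`ℂ \ (-∞, 0]`. [folklore] -/
theorem hansen_den_ne_zero {z : ℂ} (hz : z ∈ Complex.slitPlane) {l : ℝ} (hl : l ∈ Icc (0 : ℝ) 1) :
    (l : ℂ) + (1 - (l : ℂ)) * z ≠ 0 := by
  intro h0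
  rw [Complex.mem_slitPlane_iff] at hz
  have hre := congrArg Complex.re h0
  have him := congrArg Complex.im h0
  simp only [add_re, ofReal_re, mul_re, sub_re, one_re, sub_im, one_im, ofReal_im, sub_zero,
    zero_mul, sub_self, add_im, mul_im, zero_add, add_zero, Complex.zero_re, Complex.zero_im] at hre him
  rcases hl.2.lt_or_eq with hl1 | hl1
  · have h1 : 0 < 1 - l := by linarith
    have hzim : z.im = 0 := by
      rcases mul_eq_zero.mp him with h | h
      · linarith
      · exact h
    have hzre : z.re ≤ 0 := by nlinarith [hl.1]
    rcases hz with h | h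
    · linarith
    · exact h hzim
  · subst hl1
    simp at hre

/-- Locally uniform lower bound for `|λ + (1 - λ)z|` near a point of the slit plane (compactness).
[folklore] -/
theorem exists_ball_hansen_den_bound {z₀ : ℂ} (hz₀ : z₀ ∈ Complex.slitPlane) :
    ∃ R : ℝ, 0 < R ∧ ball z₀ R ⊆ Complex.slitPlane ∧ ∃ δ : ℝ, 0 < δ ∧
      ∀ z ∈ ball z₀ R, ∀ l ∈ Icc (0 : ℝ) 1, δ ≤ ‖(l : ℂ) + (1 - (l : ℂ)) * z‖ := by
  obtain ⟨ε, hε, hball⟩ := Metric.isOpen_iff.mp Complex.isOpen_slitPlane z₀ hz₀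
  set R : ℝ := ε / 2 with hR
  have hRpos : 0 < R := by rw [hR]; positivity
  have hcl : closedBall z₀ R ⊆ Complex.slitPlane := fun z hz =>
    hball (mem_ball.mpr (lt_of_le_of_lt (mem_closedBall.mp hz) (by rw [hR]; linarith)))
  set S : Set (ℂ × ℝ) := closedBall z₀ R ×ˢ Icc (0 : ℝ) 1 with hS
  have hSc : IsCompact S := (isCompact_closedBall z₀ R).prod isCompact_Icc
  have hSne : S.Nonempty := ⟨(z₀, 0), mem_closedBall_self hRpos.le, ⟨le_rfl, zero_le_one⟩⟩
  set φ : ℂ × ℝ → ℝ := fun p => ‖(p.2 : ℂ) + (1 - (p.2 : ℂ)) * p.1‖ with hφ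
  have hφc : Continuous φ := by
    rw [hφ]; fun_prop
  obtain ⟨p₀, hp₀, hmin⟩ := hSc.exists_isMinOn hSne hφc.continuousOn
  have hδ : 0 < φ p₀ := by
    rw [hφ]; dsimp only
    exact norm_pos_iff.mpr (hansen_den_ne_zero (hcl hp₀.1) hp₀.2)
  refine ⟨R, hRpos, (ball_subset_closedBall).trans hcl, φ p₀, hδ, fun z hz l hl => ?_⟩
  exact hmin (show (z, l) ∈ S from ⟨ball_subset_closedBall hz, hl⟩)

/-- The imaginary part of Hansen's kernel: `Im ((z - 1)/(λ + (1 - λ)z)) = Im z / |λ + (1 - λ)z|²`.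
[cite: Hansen2013, §5.1] -/
theorem im_hansen_kernel (z : ℂ) (l : ℝ) :
    ((z - 1) / ((l : ℂ) + (1 - (l : ℂ)) * z)).im =
      z.im / Complex.normSq ((l : ℂ) + (1 - (l : ℂ)) * z) := by
  rw [Complex.div_im]
  simp only [sub_re, one_re, sub_im, one_im, sub_zero, add_re, ofReal_re, mul_re, ofReal_im,
    zero_mul, add_im, mul_im, zero_add, add_zero, sub_self]
  rw [← sub_div]
  congr 1
  ring

/-- Hansen's kernel commutes with complex conjugation (the measure is real). [folklore] -/
theorem conj_hansen_kernel (z : ℂ) (l : ℝ) :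
    (starRingEnd ℂ) ((z - 1) / ((l : ℂ) + (1 - (l : ℂ)) * z)) =
      ((starRingEnd ℂ) z - 1) / ((l : ℂ) + (1 - (l : ℂ)) * (starRingEnd ℂ) z) := by
  simp only [map_div₀, map_sub, map_one, map_add, map_mul, Complex.conj_ofReal]

/-- **Löwner's theorem on `(0, ∞)`, hard direction** (Hansen 2013, §5.1): an operator monotone
function on the positive half-line extends to a holomorphic function on `ℂ \ (-∞, 0]`, real-symmetric,
with nonnegative imaginary part in the upper half-plane — namely
`F(z) = f(1) + f'(1) ∫₀¹ (z - 1)/(λ + (1 - λ)z) dμ(λ)`, whose kernel has `Im = Im z / |λ + (1 - λ)z|²`.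
[cite: Hansen2013, Theorem 5.4] -/
theorem exists_pick_extension_Ioi {f : ℝ → ℝ} (hf : IsMatrixMonotoneOn f (Ioi 0)) :
    ∃ F : ℂ → ℂ, DifferentiableOn ℂ F Complex.slitPlane ∧
      (∀ z : ℂ, 0 < z.im → 0 ≤ (F z).im) ∧
      (∀ z : ℂ, F ((starRingEnd ℂ) z) = (starRingEnd ℂ) (F z)) ∧ ∀ x : ℝ, 0 < x → F x = f x := by
  by_cases hnc : ∃ s₁ s₂ : ℝ, 0 < s₁ ∧ 0 < s₂ ∧ f s₁ ≠ f s₂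
  swap
  · -- constant `f`: constant extension
    push Not at hnc
    refine ⟨fun _ => (f 1 : ℂ), differentiableOn_const _, fun z _ => by simp, fun z => by simp,
      fun x hx => ?_⟩
    show ((f 1 : ℝ) : ℂ) = ((f x : ℝ) : ℂ)
    exact_mod_cast hnc 1 x one_pos hx
  obtain ⟨μ, hμ, hrep⟩ := exists_measure_repr_of_isMatrixMonotoneOn hf hnc
  have hcpos : 0 < deriv f 1 := deriv_pos_of_isMatrixMonotoneOn hf hnc one_pos
  set K : ℂ → unitInterval → ℂ := fun z l => (z - 1) / (((l : ℝ) : ℂ) + (1 - ((l : ℝ) : ℂ)) * z)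
    with hK
  set F : ℂ → ℂ := fun z => ((f 1 : ℝ) : ℂ) + ((deriv f 1 : ℝ) : ℂ) * ∫ l, K z l ∂μ with hF
  -- continuity of the kernel in `λ` and integrability
  have hKcont : ∀ z ∈ Complex.slitPlane, Continuous (K z) := by
    intro z hz
    rw [hK]
    exact continuous_const.div (by fun_prop) fun l => hansen_den_ne_zero hz l.2
  have hKint : ∀ z ∈ Complex.slitPlane, Integrable (K z) μ := fun z hz =>
    (hKcont z hz).integrable_of_hasCompactSupport (HasCompactSupport.of_compactSpace _)
  refine ⟨F, ?_, fun z hz => ?_, fun z => ?_, fun x hx => ?_⟩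
  · -- holomorphy: dominated parameter integral
    have hI : DifferentiableOn ℂ (fun z => ∫ l, K z l ∂μ) Complex.slitPlane := by
      refine differentiableOn_integral_of_dominated (fun z hz => (hKcont z hz).aestronglyMeasurable)
        (Eventually.of_forall fun l => ?_) fun z₀ hz₀ => ?_
      · rw [hK]
        refine DifferentiableOn.div (by fun_prop) (by fun_prop) fun z hz => ?_
        exact hansen_den_ne_zero hz l.2
      · obtain ⟨R, hR, hRU, δ, hδ, hbd⟩ := exists_ball_hansen_den_bound hz₀
        refine ⟨R, hR, hRU, fun _ => (‖z₀‖ + R + 1) / δ, integrable_const _,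
          Eventually.of_forall fun l z hz => ?_⟩
        rw [hK]; dsimp only
        rw [norm_div]
        have hden := hbd z hz l l.2
        have hnum : ‖z - 1‖ ≤ ‖z₀‖ + R + 1 := by
          calc ‖z - 1‖ ≤ ‖z‖ + ‖(1 : ℂ)‖ := norm_sub_le _ _
            _ ≤ (‖z₀‖ + R) + 1 := by
                rw [norm_one]
                gcongr
                calc ‖z‖ = ‖z₀ + (z - z₀)‖ := by ring_nf
                  _ ≤ ‖z₀‖ + ‖z - z₀‖ := norm_add_le _ _
                  _ ≤ ‖z₀‖ + R := by
                      have : dist z z₀ < R := hz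
                      rw [dist_eq_norm] at this
                      linarith
        calc ‖z - 1‖ / ‖((l : ℝ) : ℂ) + (1 - ((l : ℝ) : ℂ)) * z‖
            ≤ ‖z - 1‖ / δ := div_le_div_of_nonneg_left (norm_nonneg _) hδ hden
          _ ≤ (‖z₀‖ + R + 1) / δ := by gcongr
    rw [hF]
    exact (hI.const_mul _).const_add _
  · -- nonnegative imaginary part on the upper half-plane
    have hzs : z ∈ Complex.slitPlane := Complex.mem_slitPlane_iff.mpr (Or.inr hz.ne')
    rw [hF]; dsimp only
    have him : (∫ l, K z l ∂μ).im = ∫ l, (K z l).im ∂μ := by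
      have h := integral_im (hKint z hzs)
      simpa using h.symm
    have hnn : 0 ≤ ∫ l, (K z l).im ∂μ := by
      refine integral_nonneg fun l => ?_
      rw [hK]; dsimp only
      rw [im_hansen_kernel]
      exact div_nonneg hz.le (Complex.normSq_nonneg _)
    simp only [add_im, ofReal_im, mul_im, ofReal_re, zero_mul, add_zero, zero_add, him]
    exact mul_nonneg hcpos.le hnn
  · -- real symmetry
    rw [hF]; dsimp only
    simp only [map_add, map_mul, Complex.conj_ofReal]
    congr 1
    rw [← integral_conj]
    congr 1
    refine integral_congr_ae (Eventually.of_forall fun l => ?_)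
    simp only [hK]
    exact (conj_hansen_kernel z l).symm
  · -- values on `(0, ∞)`
    rw [hF, hrep x hx]; dsimp only
    have hKx : ∀ l : unitInterval, K x l =
        (((x - 1) / ((l : ℝ) + (1 - (l : ℝ)) * x) : ℝ) : ℂ) := by
      intro l
      rw [hK]; dsimp only
      push_cast
      ring_nf
    simp_rw [hKx]
    rw [integral_complex_ofReal]
    push_cast
    ring_nf

end PickExtensionHalfLine

section MonotoneTransfer

variable {n : ℕ}

/-- Composition with a matrix monotone inner function preserves matrix monotonicity.
[folklore] -/
theorem isMatrixMonotoneOn_comp {f h : ℝ → ℝ} {Δ Δ' : Set ℝ} (hf : IsMatrixMonotoneOn f Δ)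
    (hh : IsMatrixMonotoneOn h Δ') (hmaps : MapsTo h Δ' Δ) :
    IsMatrixMonotoneOn (fun t => f (h t)) Δ' := by
  intro n A B hA hB hAs hBs hAB
  have hA' : IsSelfAdjoint A := hA
  have hB' : IsSelfAdjoint B := hB
  have hfinA := Matrix.finite_real_spectrum (A := A)
  have hfinB := Matrix.finite_real_spectrum (A := B)
  have hhA : (cfc h A).IsHermitian := (cfc_predicate h A : IsSelfAdjoint _)
  have hhB : (cfc h B).IsHermitian := (cfc_predicate h B : IsSelfAdjoint _)
  have hsA : spectrum ℝ (cfc h A) ⊆ Δ := by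
    rw [cfc_map_spectrum h A (hf := hfinA.continuousOn _)]
    rintro _ ⟨x, hx, rfl⟩; exact hmaps (hAs hx)
  have hsB : spectrum ℝ (cfc h B) ⊆ Δ := by
    rw [cfc_map_spectrum h B (hf := hfinB.continuousOn _)]
    rintro _ ⟨x, hx, rfl⟩; exact hmaps (hBs hx)
  have hle := hh n A B hA hB hAs hBs hAB
  have hmain := hf n (cfc h A) (cfc h B) hhA hhB hsA hsB hle
  rw [cfc_comp' f h A ((hfinA.image _).continuousOn _) (hfinA.continuousOn _),
    cfc_comp' f h B ((hfinB.image _).continuousOn _) (hfinB.continuousOn _)]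
  exact hmain

/-- Matrix monotonicity is inherited by subsets of the domain. [folklore] -/
theorem isMatrixMonotoneOn_mono {f : ℝ → ℝ} {Δ Δ' : Set ℝ} (hf : IsMatrixMonotoneOn f Δ)
    (h : Δ' ⊆ Δ) : IsMatrixMonotoneOn f Δ' := fun n A B hA hB hAs hBs hAB =>
  hf n A B hA hB (hAs.trans h) (hBs.trans h) hAB

/-- Reflection: `f` matrix monotone on `Δ` gives `t ↦ -f(-t)` matrix monotone on `-Δ`.
[folklore] -/
theorem isMatrixMonotoneOn_neg_comp_neg {f : ℝ → ℝ} {Δ : Set ℝ} (hf : IsMatrixMonotoneOn f Δ) :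
    IsMatrixMonotoneOn (fun t => -f (-t)) ((fun t => -t) ⁻¹' Δ) := by
  intro n A B hA hB hAs hBs hAB
  have hA' : IsSelfAdjoint A := hA
  have hB' : IsSelfAdjoint B := hB
  have hnA : (-A).IsHermitian := hA.neg
  have hnB : (-B).IsHermitian := hB.neg
  have hsA : spectrum ℝ (-A) ⊆ Δ := by
    rw [← spectrum.neg_eq]; rintro x hx; simpa using hAs hx
  have hsB : spectrum ℝ (-B) ⊆ Δ := by
    rw [← spectrum.neg_eq]; rintro x hx; simpa using hBs hx
  have hle : (-A - -B).PosSemidef := by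
    have e : -A - -B = B - A := by abel
    rw [e]; exact hAB
  have h := hf n (-B) (-A) hnB hnA hsB hsA hle
  rw [cfc_neg (fun t => f (-t)) B, cfc_neg (fun t => f (-t)) A,
    cfc_comp_neg f A (hf := ((Matrix.finite_real_spectrum (A := A)).image _).continuousOn _),
    cfc_comp_neg f B (hf := ((Matrix.finite_real_spectrum (A := B)).image _).continuousOn _)]
  have e : -cfc f (-B) - -cfc f (-A) = cfc f (-A) - cfc f (-B) := by abel
  rw [e]; exact h

/-- The shift `t ↦ t + a` is matrix monotone. [folklore] -/
theorem isMatrixMonotoneOn_add_const (a : ℝ) (Δ : Set ℝ) : IsMatrixMonotoneOn (fun t => t + a) Δ :=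
  isMatrixMonotoneOn_add (isMatrixMonotoneOn_idFun Δ) (isMatrixMonotoneOn_constFun a Δ)

/-- Hansen's bijection `u ↦ u/(1 + u)` of `(0, ∞)` onto `(0, 1)` is operator monotone
(`= 1 - (1 + u)⁻¹`). [cite: Hansen2013, Theorem 5.4 (proof)] -/
theorem isMatrixMonotoneOn_div_one_add : IsMatrixMonotoneOn (fun u : ℝ => u / (1 + u)) (Ioi 0) := by
  have h1 : IsMatrixMonotoneOn (fun u : ℝ => -(u + 1)⁻¹) (Ioi 0) :=
    isMatrixMonotoneOn_comp (f := fun t : ℝ => -t⁻¹) isMatrixMonotoneOn_neg_inv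
      (isMatrixMonotoneOn_add_const 1 (Ioi 0)) fun u hu => by
        show (0 : ℝ) < u + 1
        have : (0 : ℝ) < u := hu
        linarith
  have h2 := isMatrixMonotoneOn_add (isMatrixMonotoneOn_constFun 1 (Ioi 0)) h1
  refine isMatrixMonotoneOn_congr (fun u hu => ?_) h2
  have hu' : (0 : ℝ) < u := hu
  field_simp
  ring

end MonotoneTransfer

section LoewnerAssembly

open MeasureTheory

/-- The domain `Π ∪ Π̃ ∪ (a, ∞)` is the translate of the slit plane. [folklore] -/
theorem halfPlanes_union_Ioi_subset (a : ℝ) :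
    UpperHalfPlane.upperHalfPlaneSet ∪ lowerHalfPlaneSet ∪ ((↑) '' Ioi a : Set ℂ) ⊆
      {z : ℂ | z - a ∈ Complex.slitPlane} := by
  rintro z (⟨hz | hz⟩ | ⟨x, hx, rfl⟩)
  · have hz' : 0 < z.im := hz
    exact Complex.mem_slitPlane_iff.mpr (Or.inr (by simp [hz'.ne']))
  · have hz' : z.im < 0 := hz
    exact Complex.mem_slitPlane_iff.mpr (Or.inr (by simp [hz'.ne]))
  · have hx' : a < x := hx
    refine Complex.mem_slitPlane_iff.mpr (Or.inl ?_)
    simp only [sub_re, ofReal_re]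
    linarith

/-- **Löwner's theorem on `(a, ∞)`, hard direction** (translation of the half-line case), with the
real symmetry of the extension recorded. [cite: Hansen2013, Theorem 5.4] -/
theorem exists_pick_extension_Ioi_gen {f : ℝ → ℝ} {a : ℝ} (hf : IsMatrixMonotoneOn f (Ioi a)) :
    ∃ g : ℂ → ℂ, DifferentiableOn ℂ g {z : ℂ | z - a ∈ Complex.slitPlane} ∧
      (∀ z : ℂ, 0 < z.im → 0 ≤ (g z).im) ∧
      (∀ z : ℂ, g ((starRingEnd ℂ) z) = (starRingEnd ℂ) (g z)) ∧ ∀ x : ℝ, a < x → g x = f x := by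
  have hf₁ : IsMatrixMonotoneOn (fun t => f (t + a)) (Ioi 0) :=
    isMatrixMonotoneOn_comp hf (isMatrixMonotoneOn_add_const a (Ioi 0)) fun t ht => by
      show a < t + a
      have : (0 : ℝ) < t := ht
      linarith
  obtain ⟨F, hFd, hFim, hFsymm, hFf⟩ := exists_pick_extension_Ioi hf₁
  refine ⟨fun z => F (z - a), ?_, fun z hz => ?_, fun z => ?_, fun x hx => ?_⟩
  · exact hFd.comp (differentiableOn_id.sub_const _) fun z hz => hz
  · exact hFim _ (by simpa using hz)
  · show F ((starRingEnd ℂ) z - a) = (starRingEnd ℂ) (F (z - a))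
    rw [← hFsymm]
    simp
  · show F ((x : ℂ) - a) = f x
    have h := hFf (x - a) (by linarith)
    simp only [sub_add_cancel] at h
    rw [← h]
    push_cast
    rfl

/-- **Löwner's theorem on `(-∞, b)`, hard direction** (reflection `f ↦ -f(-·)` of the half-line
case). [cite: Hansen2013, Theorem 5.4] -/
theorem exists_pick_extension_Iio {f : ℝ → ℝ} {b : ℝ} (hf : IsMatrixMonotoneOn f (Iio b)) :
    ∃ g : ℂ → ℂ, DifferentiableOn ℂ g {z : ℂ | -z + b ∈ Complex.slitPlane} ∧
      (∀ z : ℂ, 0 < z.im → 0 ≤ (g z).im) ∧ ∀ x : ℝ, x < b → g x = f x := by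
  have hf₁ : IsMatrixMonotoneOn (fun t => -f (-t)) (Ioi (-b)) := by
    have h := isMatrixMonotoneOn_neg_comp_neg hf
    refine isMatrixMonotoneOn_mono h fun t ht => ?_
    show -t < b
    have : -b < t := ht
    linarith
  obtain ⟨G, hGd, hGim, hGsymm, hGf⟩ := exists_pick_extension_Ioi_gen hf₁
  refine ⟨fun z => -G (-z), ?_, fun z hz => ?_, fun x hx => ?_⟩
  · have hmaps : MapsTo (fun z : ℂ => -z) {z : ℂ | -z + b ∈ Complex.slitPlane}
        {z : ℂ | z - ((-b : ℝ) : ℂ) ∈ Complex.slitPlane} := fun z hz => by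
      have hz' : -z + b ∈ Complex.slitPlane := hz
      show -z - ((-b : ℝ) : ℂ) ∈ Complex.slitPlane
      push_cast
      rwa [sub_neg_eq_add]
    exact (hGd.comp (differentiableOn_neg _) hmaps).neg
  · show 0 ≤ (-G (-z)).im
    have h1 : G (-z) = (starRingEnd ℂ) (G ((starRingEnd ℂ) (-z))) := by
      rw [hGsymm, Complex.conj_conj]
    have h2 : 0 ≤ (G ((starRingEnd ℂ) (-z))).im := hGim _ (by simpa using hz)
    rw [h1, Complex.neg_im, Complex.conj_im]
    linarith
  · show -G (-(x : ℂ)) = f x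
    have h := hGf (-x) (by linarith)
    push_cast at h
    rw [h]
    ring

/-- Imaginary part of Hansen's Möbius map `w ↦ w/(1 - w)`: `Im = Im w / |1 - w|²`. [folklore] -/
theorem im_div_one_sub (w : ℂ) : (w / (1 - w)).im = w.im / Complex.normSq (1 - w) := by
  rw [Complex.div_im]
  simp only [sub_re, one_re, sub_im, one_im, zero_sub]
  rw [← sub_div]
  congr 1
  ring

/-- **Löwner's theorem on a bounded interval `(a, b)`, hard direction**: reduce to `(0, 1)` by an
affine map and to `(0, ∞)` through the operator monotone bijection `u ↦ u/(1 + u)` whose inverse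
`w ↦ w/(1 - w)` maps the half-planes into themselves (Hansen 2013, proof of Theorem 5.4).
[cite: Hansen2013, Theorem 5.4] -/
theorem exists_pick_extension_Ioo {f : ℝ → ℝ} {a b : ℝ} (hab : a < b)
    (hf : IsMatrixMonotoneOn f (Ioo a b)) :
    ∃ g : ℂ → ℂ, DifferentiableOn ℂ g
        (UpperHalfPlane.upperHalfPlaneSet ∪ lowerHalfPlaneSet ∪ ((↑) '' Ioo a b : Set ℂ)) ∧
      (∀ z : ℂ, 0 < z.im → 0 ≤ (g z).im) ∧ ∀ x ∈ Ioo a b, g x = f x := by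
  have hba : 0 < b - a := by linarith
  -- transport to `(0, ∞)`
  have hf₃ : IsMatrixMonotoneOn (fun s => f (a + (b - a) * s)) (Ioo 0 1) := by
    refine isMatrixMonotoneOn_comp hf ?_ fun s hs => ⟨by nlinarith [hs.1], by nlinarith [hs.2]⟩
    exact isMatrixMonotoneOn_congr (fun s _ => by ring)
      (isMatrixMonotoneOn_add (isMatrixMonotoneOn_constFun a _)
        (isMatrixMonotoneOn_const_mul hba.le (isMatrixMonotoneOn_idFun _)))
  have hf₄ : IsMatrixMonotoneOn (fun u => f (a + (b - a) * (u / (1 + u)))) (Ioi 0) := by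
    refine isMatrixMonotoneOn_comp (f := fun s => f (a + (b - a) * s)) hf₃
      isMatrixMonotoneOn_div_one_add fun u hu => ?_
    have hu' : (0 : ℝ) < u := hu
    exact ⟨div_pos hu' (by linarith), (div_lt_one (by linarith)).mpr (by linarith)⟩
  obtain ⟨F, hFd, hFim, -, hFf⟩ := exists_pick_extension_Ioi hf₄
  -- the holomorphic change of variables `z ↦ m((z - a)/(b - a))`, `m(w) = w/(1 - w)`
  set φ : ℂ → ℂ := fun z => ((z - a) / (b - a)) / (1 - (z - a) / (b - a)) with hφ
  have hφ_ne : ∀ z : ℂ, z ∈ UpperHalfPlane.upperHalfPlaneSet ∪ lowerHalfPlaneSet ∪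
      ((↑) '' Ioo a b : Set ℂ) → (1 : ℂ) - (z - a) / (b - a) ≠ 0 := by
    rintro z hz h0
    have hz1 : (z - a) / (b - a) = 1 := by linear_combination -h0
    rw [div_eq_iff (by exact_mod_cast hba.ne'), one_mul] at hz1
    have hzb : z = (b : ℂ) := by linear_combination hz1
    subst hzb
    rcases hz with (hz | hz) | ⟨x, hx, hxz⟩
    · simp [UpperHalfPlane.upperHalfPlaneSet] at hz
    · simp [lowerHalfPlaneSet] at hz
    · have : x = b := by exact_mod_cast hxz
      exact (ne_of_lt hx.2) this
  have hw_im : ∀ z : ℂ, ((z - a) / (b - a)).im = z.im / (b - a) := by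
    intro z
    have : ((b : ℂ) - a) = ((b - a : ℝ) : ℂ) := by push_cast; rfl
    rw [this, Complex.div_ofReal_im]
    simp
  have hφ_maps : ∀ z : ℂ, z ∈ UpperHalfPlane.upperHalfPlaneSet ∪ lowerHalfPlaneSet ∪
      ((↑) '' Ioo a b : Set ℂ) → φ z ∈ Complex.slitPlane := by
    rintro z hz
    have hz0 := hz
    rw [hφ]; dsimp only
    rcases hz with (hz' | hz') | ⟨x, hx, rfl⟩
    · have hzi : 0 < z.im := hz'
      refine Complex.mem_slitPlane_iff.mpr (Or.inr ?_)
      rw [im_div_one_sub, hw_im]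
      refine (div_pos (div_pos hzi hba) ?_).ne'
      exact Complex.normSq_pos.mpr (hφ_ne z hz0)
    · have hzi : z.im < 0 := hz'
      refine Complex.mem_slitPlane_iff.mpr (Or.inr ?_)
      rw [im_div_one_sub, hw_im]
      refine (div_neg_of_neg_of_pos (div_neg_of_neg_of_pos hzi hba) ?_).ne
      exact Complex.normSq_pos.mpr (hφ_ne z hz0)
    · refine Complex.mem_slitPlane_iff.mpr (Or.inl ?_)
      have hw : (((x : ℂ) - a) / (b - a)) = (((x - a) / (b - a) : ℝ) : ℂ) := by push_cast; rfl
      rw [hw]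
      have hs : (x - a) / (b - a) ∈ Ioo (0 : ℝ) 1 :=
        ⟨div_pos (by linarith [hx.1]) hba, (div_lt_one hba).mpr (by linarith [hx.2])⟩
      have h1 : (1 : ℂ) - (((x - a) / (b - a) : ℝ) : ℂ) = ((1 - (x - a) / (b - a) : ℝ) : ℂ) := by
        push_cast; rfl
      rw [h1, ← Complex.ofReal_div, Complex.ofReal_re]
      exact div_pos hs.1 (by linarith [hs.2])
  have hφd : DifferentiableOn ℂ φ
      (UpperHalfPlane.upperHalfPlaneSet ∪ lowerHalfPlaneSet ∪ ((↑) '' Ioo a b : Set ℂ)) := by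
    rw [hφ]
    refine DifferentiableOn.div ?_ ?_ fun z hz => hφ_ne z hz
    · exact (differentiableOn_id.sub_const _).div_const _
    · exact (differentiableOn_const _).sub ((differentiableOn_id.sub_const _).div_const _)
  refine ⟨fun z => F (φ z), hFd.comp hφd fun z hz => hφ_maps z hz, fun z hz => ?_, fun x hx => ?_⟩
  · show 0 ≤ (F (φ z)).im
    apply hFim
    rw [hφ]; dsimp only
    rw [im_div_one_sub, hw_im]
    refine div_pos (div_pos hz hba) (Complex.normSq_pos.mpr (hφ_ne z ?_))
    exact Or.inl (Or.inl hz)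
  · show F (φ x) = f x
    have hs : (x - a) / (b - a) ∈ Ioo (0 : ℝ) 1 :=
      ⟨div_pos (by linarith [hx.1]) hba, (div_lt_one hba).mpr (by linarith [hx.2])⟩
    set u : ℝ := ((x - a) / (b - a)) / (1 - (x - a) / (b - a)) with hu
    have hupos : 0 < u := by rw [hu]; exact div_pos hs.1 (by linarith [hs.2])
    have hφx : φ x = (u : ℂ) := by
      rw [hφ, hu]; push_cast; rfl
    rw [hφx, hFf u hupos]
    have h1 : 1 - (x - a) / (b - a) ≠ 0 := by linarith [hs.2]
    have key : ∀ w : ℝ, w < 1 → (w / (1 - w)) / (1 + w / (1 - w)) = w := by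
      intro w hw
      have : 1 - w ≠ 0 := by linarith
      have h3 : 1 + w / (1 - w) = 1 / (1 - w) := by field_simp; ring
      rw [h3]; field_simp
    have h2 : u / (1 + u) = (x - a) / (b - a) := by rw [hu]; exact key _ hs.2
    rw [h2, mul_div_cancel₀ _ hba.ne']
    congr 1
    ring

end LoewnerAssembly

section LoewnerFinal

open MeasureTheory

/-- Adding a nonnegative real number keeps a point in the slit plane. [folklore] -/
theorem add_real_mem_slitPlane {w : ℂ} (hw : w ∈ Complex.slitPlane) {r : ℝ} (hr : 0 ≤ r) :
    w + r ∈ Complex.slitPlane := by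
  rw [Complex.mem_slitPlane_iff] at hw ⊢
  rcases hw with h | h
  · left; simp only [add_re, ofReal_re]; linarith
  · right; simpa using h

/-- A complex number of norm `< m` lies in the translate `{z | z + m ∈ ℂ \ (-∞, 0]}` of the slit
plane. [folklore] -/
theorem mem_shift_slitPlane_of_norm_lt {z : ℂ} {m : ℝ} (h : ‖z‖ < m) :
    z - ((-m : ℝ) : ℂ) ∈ Complex.slitPlane := by
  refine Complex.mem_slitPlane_iff.mpr (Or.inl ?_)
  have h1 := Complex.abs_re_le_norm z
  rw [abs_le] at h1
  simp only [sub_re, ofReal_re]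
  linarith [h1.1]

/-- **Löwner's theorem on `ℝ`, hard direction**: the holomorphic extensions obtained from the
half-lines `(-m, ∞)` agree on overlaps (identity theorem) and glue to an entire function.
[cite: Hansen2013, Theorem 5.4] -/
theorem exists_pick_extension_univ {f : ℝ → ℝ} (hf : IsMatrixMonotoneOn f univ) :
    ∃ g : ℂ → ℂ, Differentiable ℂ g ∧ (∀ z : ℂ, 0 < z.im → 0 ≤ (g z).im) ∧
      ∀ x : ℝ, g x = f x := by
  have hfm : ∀ m : ℕ, IsMatrixMonotoneOn f (Ioi (-(m : ℝ))) := fun m =>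
    isMatrixMonotoneOn_mono hf (subset_univ _)
  choose G hGd hGim _hGsymm hGf using fun m : ℕ => exists_pick_extension_Ioi_gen (hfm m)
  -- the domains `U m = {z | z + m ∈ ℂ \ (-∞, 0]}`
  set U : ℕ → Set ℂ := fun m => {z : ℂ | z - ((-(m : ℝ) : ℝ) : ℂ) ∈ Complex.slitPlane} with hU
  have hUd : ∀ m, DifferentiableOn ℂ (G m) (U m) := fun m => hGd m
  have hUopen : ∀ m, IsOpen (U m) := fun m =>
    Complex.isOpen_slitPlane.preimage (continuous_id.sub continuous_const)
  have hUconn : ∀ m, IsPreconnected (U m) := by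
    intro m
    have hsp : IsPreconnected Complex.slitPlane :=
      (Complex.starConvex_one_slitPlane.isPathConnected Complex.one_mem_slitPlane).isConnected
        |>.isPreconnected
    have heq : U m = (fun w => w + ((-(m : ℝ) : ℝ) : ℂ)) '' Complex.slitPlane := by
      ext z
      constructor
      · intro hz
        exact ⟨z - ((-(m : ℝ) : ℝ) : ℂ), hz, by ring⟩
      · rintro ⟨w, hw, rfl⟩
        show w + ((-(m : ℝ) : ℝ) : ℂ) - ((-(m : ℝ) : ℝ) : ℂ) ∈ Complex.slitPlane
        simpa using hw
    rw [heq]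
    exact hsp.image _ (by fun_prop)
  have hUmono : ∀ {m m' : ℕ}, m ≤ m' → U m ⊆ U m' := by
    intro m m' hmm' z hz
    have hz' : z - ((-(m : ℝ) : ℝ) : ℂ) ∈ Complex.slitPlane := hz
    have h := add_real_mem_slitPlane hz' (show (0 : ℝ) ≤ (m' : ℝ) - m by
      have : (m : ℝ) ≤ m' := by exact_mod_cast hmm'
      linarith)
    show z - ((-(m' : ℝ) : ℝ) : ℂ) ∈ Complex.slitPlane
    convert h using 1
    push_cast
    ring
  have hUmem : ∀ {z : ℂ} {m : ℕ}, ‖z‖ < m → z ∈ U m := fun h => mem_shift_slitPlane_of_norm_lt h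
  -- consistency on overlaps: identity theorem
  have hcons : ∀ {m m' : ℕ}, m ≤ m' → EqOn (G m') (G m) (U m) := by
    intro m m' hmm'
    have h1 : AnalyticOnNhd ℂ (G m') (U m) := ((hUd m').mono (hUmono hmm')).analyticOnNhd (hUopen m)
    have h2 : AnalyticOnNhd ℂ (G m) (U m) := (hUd m).analyticOnNhd (hUopen m)
    have h1mem : ((1 : ℝ) : ℂ) ∈ U m := by
      show ((1 : ℝ) : ℂ) - ((-(m : ℝ) : ℝ) : ℂ) ∈ Complex.slitPlane
      refine Complex.mem_slitPlane_iff.mpr (Or.inl ?_)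
      simp only [sub_re, ofReal_re]
      have : (0 : ℝ) ≤ m := Nat.cast_nonneg m
      linarith
    refine h1.eqOn_of_preconnected_of_frequently_eq h2 (hUconn m) h1mem ?_
    -- real points near `1` accumulate at `1` within `ℂ \ {1}`
    have htends : Tendsto (fun x : ℝ => (x : ℂ)) (𝓝[≠] (1 : ℝ)) (𝓝[≠] ((1 : ℝ) : ℂ)) := by
      refine tendsto_nhdsWithin_iff.mpr ⟨?_, ?_⟩
      · exact (continuous_ofReal.tendsto 1).mono_left nhdsWithin_le_nhds
      · filter_upwards [self_mem_nhdsWithin] with x hx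
        simp only [mem_compl_iff, mem_singleton_iff] at hx ⊢
        exact_mod_cast hx
    have hev : ∀ᶠ x : ℝ in 𝓝[≠] (1 : ℝ), G m' x = G m x := by
      have h0 : ∀ᶠ x : ℝ in 𝓝[≠] (1 : ℝ), (0 : ℝ) < x :=
        mem_nhdsWithin_of_mem_nhds (Ioi_mem_nhds one_pos)
      filter_upwards [h0] with x hx
      have hxm : -(m : ℝ) < x := by
        have : (0 : ℝ) ≤ m := Nat.cast_nonneg m
        linarith
      have hxm' : -(m' : ℝ) < x := by
        have : (0 : ℝ) ≤ m' := Nat.cast_nonneg m'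
        linarith
      rw [hGf m' x hxm', hGf m x hxm]
    exact htends.frequently hev.frequently
  -- the glued function
  set N : ℂ → ℕ := fun z => ⌈‖z‖⌉₊ + 1 with hN
  have hNmem : ∀ z, z ∈ U (N z) := fun z => hUmem (by
    rw [hN]; dsimp only
    have := Nat.le_ceil ‖z‖
    push_cast
    linarith)
  set g : ℂ → ℂ := fun z => G (N z) z with hg
  refine ⟨g, fun z₀ => ?_, fun z hz => hGim _ z hz, fun x => ?_⟩
  · -- near `z₀` the glued function is `G M` for a fixed `M`
    set M : ℕ := ⌈‖z₀‖⌉₊ + 2 with hM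
    have hNle : ∀ z ∈ ball z₀ 1, N z ≤ M := by
      intro z hz
      rw [hN, hM]; dsimp only
      have hz' : ‖z‖ ≤ ‖z₀‖ + 1 := by
        have h1 : dist z z₀ < 1 := hz
        rw [dist_eq_norm] at h1
        calc ‖z‖ = ‖z₀ + (z - z₀)‖ := by ring_nf
          _ ≤ ‖z₀‖ + ‖z - z₀‖ := norm_add_le _ _
          _ ≤ ‖z₀‖ + 1 := by linarith
      have h2 := Nat.ceil_le_ceil hz'
      rw [Nat.ceil_add_one (norm_nonneg _)] at h2
      omega
    have hloc : ∀ z ∈ ball z₀ 1, g z = G M z := fun z hz =>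
      (hcons (hNle z hz) (hNmem z)).symm
    have hz₀M : z₀ ∈ U M := hUmem (by
      rw [hM]; push_cast
      have := Nat.le_ceil ‖z₀‖
      linarith)
    have hdiff : DifferentiableAt ℂ (G M) z₀ :=
      (hUd M).differentiableAt ((hUopen M).mem_nhds hz₀M)
    refine hdiff.congr_of_eventuallyEq ?_
    filter_upwards [ball_mem_nhds z₀ one_pos] with z hz
    exact hloc z hz
  · show G (N x) x = f x
    apply hGf
    have h1 : ‖(x : ℂ)‖ < N x := by
      rw [hN]; dsimp only
      have := Nat.le_ceil ‖(x : ℂ)‖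
      push_cast
      linarith
    have h2 : |x| = ‖(x : ℂ)‖ := by simp
    have h3 : -x ≤ |x| := neg_le_abs x
    linarith

/-- The domain `Π ∪ Π̃ ∪ (-∞, b)` lies in the reflected translate of the slit plane. [folklore] -/
theorem halfPlanes_union_Iio_subset (b : ℝ) :
    UpperHalfPlane.upperHalfPlaneSet ∪ lowerHalfPlaneSet ∪ ((↑) '' Iio b : Set ℂ) ⊆
      {z : ℂ | -z + b ∈ Complex.slitPlane} := by
  rintro z (⟨hz | hz⟩ | ⟨x, hx, rfl⟩)
  · have hz' : 0 < z.im := hz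
    exact Complex.mem_slitPlane_iff.mpr (Or.inr (by simp [hz'.ne']))
  · have hz' : z.im < 0 := hz
    exact Complex.mem_slitPlane_iff.mpr (Or.inr (by simp [hz'.ne]))
  · have hx' : x < b := hx
    refine Complex.mem_slitPlane_iff.mpr (Or.inl ?_)
    simp only [add_re, neg_re, ofReal_re]
    linarith

/-- **Loewner's theorem** — discharge of the named fact `Literature.Analysis.Complex.loewner_theorem`
(Löwner 1934; Rosenblum–Rovnyak 1985, Ch. 2, Examples and Addenda no. 1). (←) is
`loewner_theorem_mpr` (resolvent positivity of Pick continuations). (→) follows F. Hansen's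
"fast track" [Hansen2013]: operator concavity and continuity (Theorem 2.1), Löwner's
characterization (Theorem 3.2), the Bendat–Sherman theorem (Theorems 3.6–3.7 via Hansen–Pedersen's
second-order argument), the involutions `f♯`, `f*` and the transform `T` (§4), Krein–Milman for the
compact convex class `𝒫₀` with extreme points `t/(λ + (1 - λ)t)` (Lemma 4.8, Theorem 4.9), the
resulting Pick extension `f(1) + f'(1)∫ (z - 1)/(λ + (1 - λ)z) dμ(λ)` on `ℂ \ (-∞, 0]` (§5.1), and the
reductions of a general open interval to `(0, ∞)` (Theorem 5.4; on `ℝ` the half-line extensions are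
glued by the identity theorem). [cite: RosenblumRovnyak1985, Ch. 2 Examples and Addenda no. 1 (Loewner's theorem, Parts I–II)] -/
theorem loewner_theorem_holds : loewner_theorem := by
  intro f Δ hΔo hΔc hΔn hfm hfb
  refine ⟨fun hf => ?_, loewner_theorem_mpr f Δ hΔo hΔc hΔn hfm hfb⟩
  -- an open order-connected nonempty subset of `ℝ` is `(a, b)`, `(a, ∞)`, `(-∞, b)` or `ℝ`
  have hleft : ∀ a ∈ Δ, (∀ x ∈ Δ, a ≤ x) → False := by
    intro a ha hmin
    obtain ⟨ε, hε, hball⟩ := Metric.isOpen_iff.mp hΔo a ha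
    have hmem : a - ε / 2 ∈ Δ := hball (by
      rw [mem_ball, Real.dist_eq, show a - ε / 2 - a = -(ε / 2) by ring, abs_neg,
        abs_of_pos (half_pos hε)]
      linarith)
    linarith [hmin _ hmem]
  have hright : ∀ b ∈ Δ, (∀ x ∈ Δ, x ≤ b) → False := by
    intro b hb hmax
    obtain ⟨ε, hε, hball⟩ := Metric.isOpen_iff.mp hΔo b hb
    have hmem : b + ε / 2 ∈ Δ := hball (by
      rw [mem_ball, Real.dist_eq, show b + ε / 2 - b = ε / 2 by ring, abs_of_pos (half_pos hε)]
      linarith)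
    linarith [hmax _ hmem]
  set a : ℝ := sInf Δ with ha
  set b : ℝ := sSup Δ with hb
  have hcases := hΔc.isPreconnected.mem_intervals
  simp only [Set.mem_insert_iff, Set.mem_singleton_iff] at hcases
  -- the four genuine cases, as separate claims
  have caseIoo : Δ = Ioo a b → ∃ g : ℂ → ℂ, DifferentiableOn ℂ g
      (UpperHalfPlane.upperHalfPlaneSet ∪ lowerHalfPlaneSet ∪ ((↑) '' Δ : Set ℂ)) ∧
      (∀ z ∈ UpperHalfPlane.upperHalfPlaneSet, 0 ≤ (g z).im) ∧ ∀ x ∈ Δ, g x = f x := by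
    intro h
    have hab : a < b := by
      have hne := hΔn; rw [h] at hne; exact Set.nonempty_Ioo.mp hne
    rw [h] at hf ⊢
    obtain ⟨g, hg, hgim, hgf⟩ := exists_pick_extension_Ioo hab hf
    exact ⟨g, hg, fun z hz => hgim z hz, hgf⟩
  have caseIoi : Δ = Ioi a → ∃ g : ℂ → ℂ, DifferentiableOn ℂ g
      (UpperHalfPlane.upperHalfPlaneSet ∪ lowerHalfPlaneSet ∪ ((↑) '' Δ : Set ℂ)) ∧
      (∀ z ∈ UpperHalfPlane.upperHalfPlaneSet, 0 ≤ (g z).im) ∧ ∀ x ∈ Δ, g x = f x := by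
    intro h
    rw [h] at hf ⊢
    obtain ⟨g, hg, hgim, -, hgf⟩ := exists_pick_extension_Ioi_gen hf
    exact ⟨g, hg.mono (halfPlanes_union_Ioi_subset a), fun z hz => hgim z hz,
      fun x hx => hgf x hx⟩
  have caseIio : Δ = Iio b → ∃ g : ℂ → ℂ, DifferentiableOn ℂ g
      (UpperHalfPlane.upperHalfPlaneSet ∪ lowerHalfPlaneSet ∪ ((↑) '' Δ : Set ℂ)) ∧
      (∀ z ∈ UpperHalfPlane.upperHalfPlaneSet, 0 ≤ (g z).im) ∧ ∀ x ∈ Δ, g x = f x := by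
    intro h
    rw [h] at hf ⊢
    obtain ⟨g, hg, hgim, hgf⟩ := exists_pick_extension_Iio hf
    exact ⟨g, hg.mono (halfPlanes_union_Iio_subset b), fun z hz => hgim z hz,
      fun x hx => hgf x hx⟩
  have caseUniv : Δ = univ → ∃ g : ℂ → ℂ, DifferentiableOn ℂ g
      (UpperHalfPlane.upperHalfPlaneSet ∪ lowerHalfPlaneSet ∪ ((↑) '' Δ : Set ℂ)) ∧
      (∀ z ∈ UpperHalfPlane.upperHalfPlaneSet, 0 ≤ (g z).im) ∧ ∀ x ∈ Δ, g x = f x := by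
    intro h
    rw [h] at hf ⊢
    obtain ⟨g, hg, hgim, hgf⟩ := exists_pick_extension_univ hf
    exact ⟨g, hg.differentiableOn, fun z hz => hgim z hz, fun x _ => hgf x⟩
  -- dispatch
  rcases hcases with h | h | h | h | h | h | h | h | h | h
  · exfalso
    have hab : a ≤ b := by have hne := hΔn; rw [h] at hne; exact Set.nonempty_Icc.mp hne
    exact hleft a (by rw [h]; exact left_mem_Icc.mpr hab) fun x hx => by rw [h] at hx; exact hx.1
  · exfalso
    have hab : a < b := by have hne := hΔn; rw [h] at hne; exact Set.nonempty_Ico.mp hne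
    exact hleft a (by rw [h]; exact left_mem_Ico.mpr hab) fun x hx => by rw [h] at hx; exact hx.1
  · exfalso
    have hab : a < b := by have hne := hΔn; rw [h] at hne; exact Set.nonempty_Ioc.mp hne
    exact hright b (by rw [h]; exact right_mem_Ioc.mpr hab) fun x hx => by rw [h] at hx; exact hx.2
  · exact caseIoo h
  · exfalso
    exact hleft a (by rw [h]; exact self_mem_Ici) fun x hx => by rw [h] at hx; exact hx
  · exact caseIoi h
  · exfalso
    exact hright b (by rw [h]; exact self_mem_Iic) fun x hx => by rw [h] at hx; exact hx
  · exact caseIio h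
  · exact caseUniv h
  · exfalso
    rw [h] at hΔn
    exact Set.not_nonempty_empty hΔn

end LoewnerFinal

end Literature.Analysis.Complex
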